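import Mathlib
import Summits.AnomalousDissipation.AnomalousDissipation.Theses.LimitingAbsorption
import Summits.AnomalousDissipation.AnomalousDissipation.Theorems.LimitingAbsorptionRelaxationBoundsInventoryShift
import Literature.Analysis.FluidPDE.PassiveScalarReleaseExistence
import Literature.Analysis.FluidPDE.PassiveScalarProofs
import Literature.Analysis.FluidPDE.AgeDecouplingWindows
import Literature.Analysis.FluidPDE.CheskidovAssemblyTools
import Literature.Analysis.FluidPDE.TurbWave0
import Literature.Analysis.FluidPDE.EnergyToolkit
import Literature.Analysis.FunctionSpaces.NuclearSpace
import Summits.AnomalousDissipation.AnomalousDissipation.Theorems.LimitingAbsorptionFloorUpgradeStubCosTransformNonneg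
import Literature.Analysis.FluidPDE.PassiveScalarSteadyTest
import Literature.Analysis.FluidPDE.PassiveScalarEnergyProofs
import Literature.Analysis.FluidPDE.PassiveScalarFourier
import Summits.AnomalousDissipation.AnomalousDissipation.Theorems.LimitingAbsorptionKinematicSteadySourceLawToolkit
import Literature.Analysis.SpecialFunctions.BesselJZeroFermiIntegral
import HarnessLib

/-!
# Disproof of `FloorUpgrade` (stmt-AnomalousDissipation-15010) — findings (cdisprove seat, cycle 1)

Crux r4 of route `LimitingAbsorption`:
`FloorUpgrade := RelaxingFamily → UniformRelaxationWitness` (Green–Kubo / absorbed-power floor upgrade).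
Everything below elaborates; no `sorry`. Index:

0. LOGICAL SHAPE (`not_floorUpgrade_iff`, `floorUpgrade_of_uniformRelaxationWitness`,
   `floorUpgrade_of_not_relaxingFamily`). `¬FloorUpgrade ↔ RelaxingFamily ∧ ¬X`: an unconditional kill
   needs a PROOF of r3 (the route's open analytic heart) plus a refutation of X, so this seat works on
   the mechanism and on the picked line; every `FloorUpgradeWithout<H>` (a clause of r3 dropped) is again
   `… → X` and is refutable only together with `¬X` — the load-bearing analysis is done on the LINE.
1. JUNK AUDIT of the typed classes (no finding): `(U_h)` quantifies over `Torus.IsWeakScalarTransportOn`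
   = `L^∞_t L²_x` weak solutions, unique for the locally bounded drifts of the crux (tree:
   `KinematicSteadySourceLaw.ae_eq_of_memLp_top`), releases exist (`Torus.IsGlobalLerayHopf.exists_release`);
   `(ABS)` uses `longTimeAvgSup` of `ν‖∇θ‖²` of a forced weak solution from datum `0`, unique by
   `forced_ae_eq_of_memLp_top`; `meanEnergy` is a real `limsup` (junk `0` if unbounded) but planar LH
   energies are bounded. No junk model refutes r3 or proves X.
2. LINE `SketchIdeator1` (PICKED; idea `bochner-zero-frequency-floor`) — ITS FAST CLASS IS EMPTY
   (UNCONDITIONAL since §6–7: B1 = `stub_ballistic` is proved here, `ballistic_bound`, general dimension;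
   `fastRelaxingFamily_false : ¬FastRelaxingFamily`):
   * `FastRelaxingFamily` := VERBATIM the hypothesis `hfast` of `stub_fastFloorUpgrade` (= conclusion of
     `stub_boost`); `Ballistic` := VERBATIM the statement of `stub_ballistic` (B1; PROVED in §6, landing as
     `Theorems/FloorUpgrade/Negative/BallisticBound.lean` — the lead may import `ballistic_bound`).
   * `energy_floor_of_ballistic` (TRANSPORT SPEED LIMIT, tightness-type lemma): modulo B1, every family of
     global LH drifts with `(U_h)` for a smooth `h ≠ 0`, `‖∇h‖ ≤ G`, eventual Cesàro energy `≤ E` has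
     `7 γ² ‖h‖²₂ ≤ 1440 C^{1/3} G² E` — no incompressible stirring relaxes a profile faster than it sweeps
     it (paper-sharp form: `‖h‖²(1 - √C e^{-γs/2}) ≤ 2 G² E s²` for all `s > 0`, i.e.
     `γ ≲ (G√E/‖h‖) log(e+C)`). This is also a NECESSARY CONDITION on every witness of r3.
   * `fastRelaxingFamily_false_of_ballistic : Ballistic → ¬ FastRelaxingFamily`: FAST asks
     `γ ≥ 16 C^{1/6} G√E/‖h‖`, above the speed limit for every `C ≥ 1`. Hence `stub_fastFloorUpgrade`
     is VACUOUS and `stub_boost ⟺ ¬RelaxingFamily`: the composition `stub_fastFloorUpgrade (stub_boost hR)`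
     closes the crux only by refuting the route. Negative/ files (--supports stmt-15010):
     `SpeedLimitTools` (p101751 ✓), `BallisticBound` (B1, p104131 ✓), `SlowRegimeNoFloor` (p104588 ✓),
     `FastClassEmpty` (p105829 ✓, v2, def-free: `energy_floor`, `fastRelaxingFamily_false` with `hfast`
     inlined verbatim), `SpeedLimitSharp` (p105650 ✓:
     `relaxation_speed_limit` — the SHARP form `‖h‖²(1 - √C e^{-γs/2}) ≤ 2G²E s²` for EVERY lag `s > 0`,
     unconditional; `γ ≲ (G√E/‖h‖) log(e + C)`).
   * Stubs A1–A4 (Bochner floor) and B1 were checked on paper and are TRUE as stated (A4's constants: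
     `πC(0) ≤ 8Λρ(0) + (128/3)AΛ³/γ³ + πδ/(2Λ) + πC(0)/12` ⇒ `ρ(0) ≥ 0.24 C(0)/Λ`); but A4's `hfast` is
     load-bearing in the strong sense: under PD + exponential envelope + curvature ALONE the zero-frequency
     mass can vanish EXACTLY (`K(τ) = (1 - τ²/2) e^{-τ²/4} = -2 (e^{-τ²/4})''`: PD, `K(0) = 1`,
     `1 - K(τ) ≤ (3/4)τ²`, `∫₀^∞ K = √π - √π = 0`) — so in the SLOW regime (the only non-empty one) the
     kernel axiomatics of the card cannot give a floor; new input on the lag kernel is required.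
     FORMALISED in §5 below: `slowKernel` = `charFun (2x²·N(0,1/2))` (positive-definite by the easy
     half of Bochner), `exists_pd_kernel_zero_mass`, and `zeroFrequencyFloor_false_without_fast`
     (= the line's `zeroFrequencyFloor` with the single hypothesis `hfast` deleted is FALSE). Landing
     as `Theorems/FloorUpgrade/Negative/SlowRegimeNoFloor.lean`.
3. WHY THE CRUX RESISTS A DISPROOF. Energy alone floors the absorbed power only at order `ν`:
   for any stirring with mean energy `E = ⟨‖v‖²⟩` and a single-mode source (`-Δh = λh`),
   `P_ν = ν⟨‖∇θ‖²⟩ ≥ ν‖h‖²/(ν²λ² + Eλ)` (Thiffeault, Nonlinearity 25 (2012) R1 = arXiv:1105.1101 §6,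
   bound (hSobo1bound), from Doering–Thiffeault PRE 74 (2006) 025301(R) / Shaw–Thiffeault–Doering,
   Physica D 231 (2007)), and the bound is SATURATED by the uniform constant flow — the minimiser of the
   absorbed power at fixed energy is pure SWEEPING, which does not relax at all. So `(U_h)` must do all
   the work of upgrading `ν` to `O(1)`, and sweeping is the extremiser to beat. The only cancellation
   mechanism found for the absorbed power
   `P = lim-avg ∫₀ᵗ⟨h, S(t,t-τ)h⟩dτ` is coherent SWEEPING of the steady source (Galilean decorrelation; in
   the 2×2 rotation–damping toy `K_U(τ) = e^{-γτ}cos(Uτ)`, `P(U) = γ‖h‖²/(γ²+U²)`), and sweeping is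
   capped by the energy: bounded `E` keeps `P ≳ γ‖h‖²/(γ² + Λ²)` in every toy tried (constant, bursty and
   Poisson-switched sweeping: `P ≥ ‖h‖²/(γ+λ)` with switching rate `λ ≲ √E/ℓ`). A KILL of the mechanism
   would need a bounded-energy relaxing family whose lag-kernel spectrum has a double zero pinned at the
   sweeping frequency for ALL large `j`; no NS or kinematic construction of that is in reach (and X's `ε`
   is existential, so `P_j` small-but-positive does not kill). Independent numerical cross-check
   (ideator 2, `Cruxes/FloorUpgrade/ToyResultsIdeator2.md`, kit jobs j015682/j016520/j017839): under
   chaotic alternating-shear stirring (κ-uniform late relaxation rate ≈ 0.95 in the random-phase protocol)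
   a generic steady source has a κ-INDEPENDENT absorbed power (`P_D → 0.044 = 0.088‖h‖²` over the last ×16
   in κ) and sources non-zero at pinned hyperbolic points absorb 6–7× more — the floor resists numerically
   as well. A PROOF, conversely, must control the NEGATIVE part of the lag kernel by the energy —
   information absent from `(U_h)` (envelope only).
4. TARGETS (lead's stuck stubs): none posted yet (payload.targets = ∅). Attacked anyway: all stubs of the
   picked skeleton; verdicts above (evidence notes `stub-misstated: stub_fastFloorUpgrade`,
   `stub-proved: stub_ballistic` on the item). §8 is the kernel-checked TOY of §3 (swept single mode:
   `P(U) = γL/(γ²+U²) → 0`, envelope blind to `U`, floor `γL/(γ²+U₀²)` under a capped sweep).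
-/

noncomputable section

open MeasureTheory Set Filter Function TopologicalSpace Topology
open scoped ENNReal NNReal InnerProductSpace

namespace Summit.AnomalousDissipation.AnomalousDissipation.Cruxes.FloorUpgrade.Disproof

set_option linter.dupNamespace false -- D-0017: `Summit.<S>.<S>.…` namespace by design

open Literature.Analysis Literature.Analysis.FluidPDE Literature.Analysis.FluidPDE.Torus
open Summit.AnomalousDissipation.AnomalousDissipation.Theses.LimitingAbsorption

/-! ## Elementary lemmas -/

/-- A smooth profile `h ≠ 0` has `‖h‖²_{L²} > 0`. [folklore] -/
theorem scalarL2Sq_pos_of_ne_zero {h : UnitAddTorus (Fin 2) → ℝ} (hh : FunctionSpaces.Torus.IsSmooth h) (hh0 : h ≠ 0) :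
    0 < scalarL2Sq h := by
  unfold scalarL2Sq
  rw [integral_pos_iff_support_of_nonneg (fun x => sq_nonneg (h x)) (hh.memLp 2).integrable_sq]
  have hsupp : Function.support (fun x => h x ^ 2) = Function.support h := by
    ext x; simp
  rw [hsupp]
  obtain ⟨x, hx⟩ : ∃ x, h x ≠ 0 := Function.ne_iff.1 hh0
  exact (isOpen_ne_fun hh.continuous continuous_const).measure_pos volume ⟨x, hx⟩

/-- The numerical heart: `y⁶ e^{-6y} ≤ 1/64` for `y ≥ 1` (`y ≤ e^{y-1}`, `e ≥ 2`). [folklore] -/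
theorem pow_six_mul_exp_le {y : ℝ} (hy : 1 ≤ y) : y ^ 6 * Real.exp (-(6 * y)) ≤ 1 / 64 := by
  have hy0 : 0 ≤ y := by linarith
  have h1 : y ≤ Real.exp (y - 1) := by linarith [Real.add_one_le_exp (y - 1)]
  have h2 : y * Real.exp (-y) ≤ Real.exp (-1) := by
    calc y * Real.exp (-y) ≤ Real.exp (y - 1) * Real.exp (-y) := by
          gcongr
      _ = Real.exp (-1) := by rw [← Real.exp_add]; ring_nf
  have h3 : Real.exp (-1) ≤ 1 / 2 := by
    have he : (2 : ℝ) ≤ Real.exp 1 := by linarith [Real.add_one_le_exp (1 : ℝ)]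
    rw [Real.exp_neg, one_div]
    exact inv_anti₀ (by norm_num) he
  have h4 : y ^ 6 * Real.exp (-(6 * y)) = (y * Real.exp (-y)) ^ 6 := by
    rw [mul_pow, ← Real.exp_nat_mul]
    congr 1
    push_cast
    ring_nf
  rw [h4]
  have h5 : 0 ≤ y * Real.exp (-y) := mul_nonneg hy0 (Real.exp_pos _).le
  calc (y * Real.exp (-y)) ^ 6 ≤ (1 / 2) ^ 6 := pow_le_pow_left₀ h5 (h2.trans h3) 6
    _ = 1 / 64 := by norm_num

/-- Pointwise-in-time comparison `∫ ⟪w, ∇h⟫² ≤ G² ∫ ‖w‖²` for an `L²` slice `w` and a gradient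
bound `‖∇h‖ ≤ G`. [folklore] -/
theorem integral_inner_gradient_sq_le {w : UnitAddTorus (Fin 2) → EuclideanSpace ℝ (Fin 2)} (hw : MemLp w 2 volume) {h : UnitAddTorus (Fin 2) → ℝ}
    {G : ℝ} (hG : ∀ x, ‖FunctionSpaces.Torus.gradient h x‖ ≤ G) :
    ∫ x, (⟪w x, FunctionSpaces.Torus.gradient h x⟫_ℝ) ^ 2 ≤ G ^ 2 * ∫ x, ‖w x‖ ^ 2 := by
  rw [← integral_const_mul]
  have hint : Integrable (fun x => ‖w x‖ ^ 2) volume :=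
    (memLp_two_iff_integrable_sq_norm hw.1).1 hw
  refine integral_mono_of_nonneg (Eventually.of_forall fun x => sq_nonneg _) (hint.const_mul _)
    (Eventually.of_forall fun x => ?_)
  have h1 : |⟪w x, FunctionSpaces.Torus.gradient h x⟫_ℝ| ≤ ‖w x‖ * G :=
    (abs_real_inner_le_norm _ _).trans (mul_le_mul_of_nonneg_left (hG x) (norm_nonneg _))
  calc (⟪w x, FunctionSpaces.Torus.gradient h x⟫_ℝ) ^ 2
        = |⟪w x, FunctionSpaces.Torus.gradient h x⟫_ℝ| ^ 2 := (sq_abs _).symm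
    _ ≤ (‖w x‖ * G) ^ 2 := pow_le_pow_left₀ (abs_nonneg _) h1 2
    _ = G ^ 2 * ‖w x‖ ^ 2 := by ring

/-- Square-root form of `integral_inner_gradient_sq_le`: `‖w·∇h‖₂ ≤ G ‖w‖₂`. [folklore] -/
theorem sqrt_integral_inner_gradient_sq_le {w : UnitAddTorus (Fin 2) → EuclideanSpace ℝ (Fin 2)} (hw : MemLp w 2 volume) {h : UnitAddTorus (Fin 2) → ℝ}
    {G : ℝ} (hG : ∀ x, ‖FunctionSpaces.Torus.gradient h x‖ ≤ G) :
    Real.sqrt (∫ x, (⟪w x, FunctionSpaces.Torus.gradient h x⟫_ℝ) ^ 2) ≤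
      G * Real.sqrt (∫ x, ‖w x‖ ^ 2) := by
  have hG0 : 0 ≤ G := (norm_nonneg _).trans (hG 0)
  calc Real.sqrt (∫ x, (⟪w x, FunctionSpaces.Torus.gradient h x⟫_ℝ) ^ 2)
        ≤ Real.sqrt (G ^ 2 * ∫ x, ‖w x‖ ^ 2) := Real.sqrt_le_sqrt (integral_inner_gradient_sq_le hw hG)
    _ = G * Real.sqrt (∫ x, ‖w x‖ ^ 2) := by
        rw [Real.sqrt_mul (sq_nonneg G), Real.sqrt_sq hG0]

/-- Cauchy–Schwarz in time on `(0,S)`: `(∫₀^S √F)² ≤ S ∫₀^S F` for a continuous `F ≥ 0`. [folklore] -/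
theorem sq_setIntegral_sqrt_le {F : ℝ → ℝ} {S : ℝ} (hS : 0 ≤ S) (hF : ContinuousOn F (Icc 0 S))
    (hF0 : ∀ t ∈ Icc 0 S, 0 ≤ F t) :
    (∫ τ in Ioo 0 S, Real.sqrt (F τ)) ^ 2 ≤ S * ∫ τ in Ioo 0 S, F τ := by
  have hg : ContinuousOn (fun τ => Real.sqrt (F τ)) (Icc 0 S) :=
    Real.continuous_sqrt.comp_continuousOn hF
  obtain ⟨B, hB⟩ := isCompact_Icc.exists_bound_of_continuousOn hg
  haveI : IsFiniteMeasure ((volume : Measure ℝ).restrict (Ioo 0 S)) :=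
    ⟨by rw [Measure.restrict_apply_univ, Real.volume_Ioo]; exact ENNReal.ofReal_lt_top⟩
  have hgm : AEStronglyMeasurable (fun τ => Real.sqrt (F τ)) (volume.restrict (Ioo 0 S)) :=
    (hg.mono Ioo_subset_Icc_self).aestronglyMeasurable measurableSet_Ioo
  have hg2 : MemLp (fun τ => Real.sqrt (F τ)) 2 (volume.restrict (Ioo 0 S)) := by
    refine (memLp_top_of_bound hgm B ?_).mono_exponent le_top
    filter_upwards [ae_restrict_mem measurableSet_Ioo] with τ hτ
    exact hB τ (Ioo_subset_Icc_self hτ)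
  have h1 : MemLp (fun _ : ℝ => (1 : ℝ)) 2 (volume.restrict (Ioo 0 S)) := memLp_const 1
  have hcs := integral_mul_le_sqrt_mul_sqrt_of_memLp h1 hg2
  have e1 : ∫ τ in Ioo 0 S, (1 : ℝ) * Real.sqrt (F τ) = ∫ τ in Ioo 0 S, Real.sqrt (F τ) := by
    simp
  have e2 : ∫ _ in Ioo 0 S, (1 : ℝ) ^ 2 = S := by
    simp [hS]
  have e3 : ∫ τ in Ioo 0 S, (Real.sqrt (F τ)) ^ 2 = ∫ τ in Ioo 0 S, F τ := by
    refine integral_congr_ae ?_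
    filter_upwards [ae_restrict_mem measurableSet_Ioo] with τ hτ
    exact Real.sq_sqrt (hF0 τ (Ioo_subset_Icc_self hτ))
  rw [e1, e2, e3] at hcs
  have h0 : 0 ≤ ∫ τ in Ioo 0 S, Real.sqrt (F τ) := integral_nonneg fun τ => Real.sqrt_nonneg _
  have hF0' : 0 ≤ ∫ τ in Ioo 0 S, F τ :=
    setIntegral_nonneg measurableSet_Ioo fun τ hτ => hF0 τ (Ioo_subset_Icc_self hτ)
  calc (∫ τ in Ioo 0 S, Real.sqrt (F τ)) ^ 2
        ≤ (Real.sqrt S * Real.sqrt (∫ τ in Ioo 0 S, F τ)) ^ 2 := pow_le_pow_left₀ h0 hcs 2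
    _ = S * ∫ τ in Ioo 0 S, F τ := by rw [mul_pow, Real.sq_sqrt hS, Real.sq_sqrt hF0']

/-! ## 0. Logical shape of the crux -/

/-- `FloorUpgrade` is a material implication between two CLOSED statements: it fails iff the route's
analytic heart `RelaxingFamily` (r3) holds while thesis X = `UniformRelaxationWitness` fails. An
unconditional disproof must therefore PROVE r3; an unconditional proof that does not prove X outright
must USE r3's family. [folklore] -/
theorem not_floorUpgrade_iff : ¬ FloorUpgrade ↔ (RelaxingFamily ∧ ¬ UniformRelaxationWitness) := by
  unfold FloorUpgrade; tauto

/-- If X holds the crux is trivial (the hypothesis is discarded). [folklore] -/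
theorem floorUpgrade_of_uniformRelaxationWitness (hX : UniformRelaxationWitness) : FloorUpgrade :=
  fun _ => hX

/-- If r3 fails the crux is vacuous — and the route is dead. [folklore] -/
theorem floorUpgrade_of_not_relaxingFamily (hR : ¬ RelaxingFamily) : FloorUpgrade :=
  fun h => (hR h).elim

/-! ## The two statements of the line, verbatim -/

/-- **The FAST relaxing-family class** of line `SketchIdeator1` of the crux `FloorUpgrade`: VERBATIM
the hypothesis `hfast` of the lead's `stub_fastFloorUpgrade` (= the conclusion of `stub_boost`):
`RelaxingFamily`'s data and clauses with jointly smooth velocities on `[0,∞) × T²`, `1 ≤ C`, a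
gradient bound `G`, an honest eventual Cesàro mean-energy bound `E`, and `256 C^{1/3} G² E ≤ γ² ‖h‖²`.
[folklore] -/
def FastRelaxingFamily : Prop :=
  ∃ (g : UnitAddTorus (Fin 2) → EuclideanSpace ℝ (Fin 2)) (h : UnitAddTorus (Fin 2) → ℝ),
      Literature.Analysis.FunctionSpaces.Torus.IsSmooth g ∧
      Literature.Analysis.FunctionSpaces.Torus.IsDivFree g ∧
      Literature.Analysis.FunctionSpaces.Torus.HasZeroMean g ∧
      Literature.Analysis.FunctionSpaces.Torus.IsSmooth h ∧
      Literature.Analysis.FunctionSpaces.Torus.HasZeroMean h ∧ h ≠ 0 ∧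
      ∃ (ν : ℕ → ℝ) (v₀ : ℕ → UnitAddTorus (Fin 2) → EuclideanSpace ℝ (Fin 2))
        (v : ℕ → ℝ → UnitAddTorus (Fin 2) → EuclideanSpace ℝ (Fin 2)),
        (∀ j, 0 < ν j) ∧ Filter.Tendsto ν Filter.atTop (nhds 0) ∧
        (∀ j, Literature.Analysis.FluidPDE.Torus.IsGlobalLerayHopf (ν j) (fun _ => g) (v₀ j) (v j)) ∧
        (∀ j : ℕ, ∀ (T : ℝ), 0 < T → MeasureTheory.MemLp
          (Literature.Analysis.FunctionSpaces.Torus.stLift (v j)) ⊤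
          (MeasureTheory.volume.restrict (Set.Ioo (0 : ℝ) T ×ˢ Set.univ))) ∧
        (∀ j, Literature.Analysis.FunctionSpaces.Torus.IsSmoothSpaceTimeOn (Set.Ici (0 : ℝ)) (v j)) ∧
        ∃ E C γ G : ℝ, (∀ j, Literature.Analysis.FluidPDE.meanEnergy (v j) ≤ E) ∧
          (∀ j, ∀ᶠ T in Filter.atTop,
            Literature.Analysis.FluidPDE.timeMean (fun t => ∫ x, ‖v j t x‖ ^ 2) T ≤ E) ∧
          1 ≤ C ∧ 0 < γ ∧
          (∀ x, ‖Literature.Analysis.FunctionSpaces.Torus.gradient h x‖ ≤ G) ∧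
          256 * C ^ ((1 : ℝ) / 3) * G ^ 2 * E ≤
            γ ^ 2 * Literature.Analysis.FluidPDE.Torus.scalarL2Sq h ∧
          ∀ (j : ℕ) (s : ℝ), 0 ≤ s → ∀ (T : ℝ) (θ : ℝ → UnitAddTorus (Fin 2) → ℝ),
            Literature.Analysis.FluidPDE.Torus.IsWeakScalarTransportOn T (ν j)
              (fun t => v j (s + t)) h θ →
            ∀ᵐ t ∂(MeasureTheory.volume.restrict (Set.Ioo (0 : ℝ) T)),
              Literature.Analysis.FluidPDE.Torus.scalarL2Sq (θ t) ≤
                C * Real.exp (-(γ * t)) * Literature.Analysis.FluidPDE.Torus.scalarL2Sq h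

/-- **The ballistic short-lag structure bound (B1)**, VERBATIM the statement of the lead's
`stub_ballistic` (line `SketchIdeator1`), as a proposition: for `κ > 0`, a smooth profile `h` with
`‖Δh‖₂ ≤ Dh`, an essentially bounded drift `u` on `(0,T) × T²` and a weak solution `θ` of
`∂ₜθ + u·∇θ = κΔθ`, `θ(0) = h` on `[0,T)`:
`‖h‖² - ⟨h, θ(s)⟩ ≤ 2κ s ‖h‖ Dh + 2 (∫₀ˢ ‖u(τ)·∇h‖₂ dτ)²` for a.e. `s ∈ (0,T)` (test the equation
against the steady field `h`, `⟨h, u·∇h⟩ = 0`, `L²` contraction, running maximum). [folklore] -/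
def Ballistic : Prop :=
  ∀ (κ T Dh : ℝ) (u : ℝ → UnitAddTorus (Fin 2) → EuclideanSpace ℝ (Fin 2))
    (h : UnitAddTorus (Fin 2) → ℝ) (θ : ℝ → UnitAddTorus (Fin 2) → ℝ), 0 < κ →
    Literature.Analysis.FunctionSpaces.Torus.IsSmooth h → 0 ≤ Dh →
    Literature.Analysis.FluidPDE.Torus.scalarL2Sq
        (Literature.Analysis.FunctionSpaces.Torus.laplacian h) ≤ Dh ^ 2 →
    MemLp (Literature.Analysis.FunctionSpaces.Torus.stLift u) ⊤
        (volume.restrict (Ioo (0 : ℝ) T ×ˢ univ)) →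
    Literature.Analysis.FluidPDE.Torus.IsWeakScalarTransportOn T κ u h θ →
    ∀ᵐ s ∂(volume.restrict (Ioo (0 : ℝ) T)),
      Literature.Analysis.FluidPDE.Torus.scalarL2Sq h - ∫ x, h x * θ s x ≤
        2 * κ * s * Real.sqrt (Literature.Analysis.FluidPDE.Torus.scalarL2Sq h) * Dh +
        2 * (∫ τ in Ioo (0 : ℝ) s, Real.sqrt (∫ x,
              (⟪u τ x, Literature.Analysis.FunctionSpaces.Torus.gradient h x⟫_ℝ) ^ 2)) ^ 2

/-! ## The theorems -/

set_option maxHeartbeats 800000 in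
/-- **Transport speed limit: the mean-energy floor of a relaxing family.** If a family of global
Leray–Hopf drifts `v_j` (any forces `f_j`), jointly smooth and essentially bounded on bounded time
slabs, relaxes a smooth profile `h ≠ 0` `ν`-uniformly and phase-uniformly with constants `(C, γ)`,
`C ≥ 1` — the clause `(U_h)` of `RelaxingFamily` — and `‖∇h‖ ≤ G`, then every eventual Cesàro bound `E`
of the energies `∫‖v_j‖²` obeys `7 γ² ‖h‖²₂ ≤ 1440 C^{1/3} G² E` (modulo B1 = `Ballistic`): relaxation at
rate `γ` needs sweeping at speed `≳ γ ‖h‖₂ / (G C^{1/6})`. A necessary condition on every witness of the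
crux `RelaxingFamily` (r3) and the reason the fast class of line `SketchIdeator1` is empty
(`fastRelaxingFamily_false_of_ballistic`). [folklore] -/
theorem energy_floor_of_ballistic (hB : Ballistic) {h : UnitAddTorus (Fin 2) → ℝ}
    (hh : FunctionSpaces.Torus.IsSmooth h) (hh0 : h ≠ 0) {ν : ℕ → ℝ} {f : ℕ → ℝ → UnitAddTorus (Fin 2) → EuclideanSpace ℝ (Fin 2)}
    {v₀ : ℕ → UnitAddTorus (Fin 2) → EuclideanSpace ℝ (Fin 2)} {v : ℕ → ℝ → UnitAddTorus (Fin 2) → EuclideanSpace ℝ (Fin 2)} (hν : ∀ j, 0 < ν j)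
    (hνlim : Tendsto ν atTop (𝓝 0)) (hLH : ∀ j, IsGlobalLerayHopf (ν j) (f j) (v₀ j) (v j))
    (hbd : ∀ j : ℕ, ∀ (T : ℝ), 0 < T →
      MemLp (FunctionSpaces.Torus.stLift (v j)) ⊤ (volume.restrict (Ioo (0 : ℝ) T ×ˢ univ)))
    (hsm : ∀ j, FunctionSpaces.Torus.IsSmoothSpaceTimeOn (Ici (0 : ℝ)) (v j)) {E C γ G : ℝ}
    (hEmean : ∀ j, ∀ᶠ T in atTop, timeMean (fun t => ∫ x, ‖v j t x‖ ^ 2) T ≤ E)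
    (hC1 : 1 ≤ C) (hγ : 0 < γ) (hG : ∀ x, ‖FunctionSpaces.Torus.gradient h x‖ ≤ G)
    (hU : ∀ (j : ℕ) (s : ℝ), 0 ≤ s → ∀ (T : ℝ) (θ : ℝ → UnitAddTorus (Fin 2) → ℝ),
      IsWeakScalarTransportOn T (ν j) (fun t => v j (s + t)) h θ →
        ∀ᵐ t ∂(volume.restrict (Ioo (0 : ℝ) T)),
          scalarL2Sq (θ t) ≤ C * Real.exp (-(γ * t)) * scalarL2Sq h) :
    7 * γ ^ 2 * scalarL2Sq h ≤ 1440 * C ^ ((1 : ℝ) / 3) * G ^ 2 * E := by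
  -- profile constants
  have hL : 0 < scalarL2Sq h := scalarL2Sq_pos_of_ne_zero hh hh0
  set L : ℝ := scalarL2Sq h with hLdef
  have hG0 : 0 ≤ G := (norm_nonneg _).trans (hG 0)
  set Dh : ℝ := Real.sqrt (scalarL2Sq (FunctionSpaces.Torus.laplacian h)) with hDhdef
  have hDh0 : 0 ≤ Dh := Real.sqrt_nonneg _
  have hΔ : scalarL2Sq (FunctionSpaces.Torus.laplacian h) ≤ Dh ^ 2 := by
    rw [hDhdef, Real.sq_sqrt (scalarL2Sq_nonneg _)]
  -- `y = C^{1/6}`, `s₀ = 6y/γ`, `S = 3 s₀ / 2`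
  have hC0 : 0 ≤ C := zero_le_one.trans hC1
  set y : ℝ := C ^ ((1 : ℝ) / 6) with hydef
  have hy1 : 1 ≤ y := Real.one_le_rpow hC1 (by norm_num)
  have hy0 : 0 < y := zero_lt_one.trans_le hy1
  have hy6 : y ^ 6 = C := by
    rw [hydef, ← Real.rpow_natCast, ← Real.rpow_mul hC0]
    norm_num
  have hy2 : y ^ 2 = C ^ ((1 : ℝ) / 3) := by
    rw [hydef, ← Real.rpow_natCast, ← Real.rpow_mul hC0]
    norm_num
  set s₀ : ℝ := 6 * y / γ with hs₀def
  have hs₀ : 0 < s₀ := by positivity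
  have hγs₀ : γ * s₀ = 6 * y := by rw [hs₀def]; field_simp
  set S : ℝ := 3 * s₀ / 2 with hSdef
  have hS0 : 0 < S := by positivity
  have hs₀S : s₀ < S := by rw [hSdef]; linarith
  -- the energies `f j t = ∫ ‖v j t‖²`
  set f : ℕ → ℝ → ℝ := fun j t => ∫ x, ‖v j t x‖ ^ 2 with hfdef
  have hf0 : ∀ j t, 0 ≤ f j t := fun j t => integral_nonneg fun x => sq_nonneg _
  have hfc : ∀ j, ContinuousOn (f j) (Ici 0) := fun j =>
    (hsm j).continuousOn_integral_norm_sq (convex_Ici 0)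
  have hfi : ∀ j T, IntegrableOn (f j) (Ioc 0 T) volume := fun j T =>
    (((hfc j).mono Icc_subset_Ici_self).integrableOn_compact isCompact_Icc).mono_set
      Ioc_subset_Icc_self
  have hfca : ∀ j (a : ℝ), 0 ≤ a → ∀ S', ContinuousOn (fun τ => f j (a + τ)) (Icc 0 S') := by
    intro j a ha S'
    refine (hfc j).comp (continuousOn_const.add continuousOn_id) fun τ hτ => ?_
    exact mem_Ici.2 (by linarith [hτ.1])
  have hvL2 : ∀ j (t : ℝ), 0 ≤ t → MemLp (v j t) 2 volume := fun j t ht =>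
    (hLH j (t + 1) (by linarith)).memLp t ⟨ht, by linarith⟩
  -- `E ≥ 0`
  have hE0 : 0 ≤ E := by
    obtain ⟨T₀, hT₀⟩ := eventually_atTop.1 (hEmean 0)
    have hT : 0 < max T₀ 1 := lt_max_of_lt_right zero_lt_one
    have h1 := hT₀ (max T₀ 1) (le_max_left _ _)
    have h2 : 0 ≤ timeMean (fun t => ∫ x, ‖v 0 t x‖ ^ 2) (max T₀ 1) :=
      mul_nonneg (inv_nonneg.2 hT.le) (intervalIntegral.integral_nonneg hT.le fun t _ => hf0 0 t)
    exact h2.trans h1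
  /- Step A: at every level `j` and every phase `a ≥ 0`,
     `7L/8 ≤ 3 ν_j s₀ √L Dh + 3 G² s₀ ∫_{(0,S)} f_j(a + τ) dτ`. -/
  have stepA : ∀ j (a : ℝ), 0 ≤ a →
      7 * L / 8 ≤ 3 * ν j * s₀ * Real.sqrt L * Dh + 3 * G ^ 2 * s₀ * ∫ τ in Ioo 0 S, f j (a + τ) := by
    intro j a ha
    set T : ℝ := 2 * s₀ with hTdef
    have hT0 : 0 < T := by positivity
    have hST : S < T := by rw [hSdef, hTdef]; linarith
    obtain ⟨Θ, hΘ, -⟩ := (hLH j).exists_release (hν j) hT0 ha (hh.memLp 2)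
    -- (U_h) at phase `a`
    have hUh := hU j a ha T Θ hΘ
    -- B1 at phase `a`
    have hu' : MemLp (FunctionSpaces.Torus.stLift (fun t => v j (a + t))) ⊤
        (volume.restrict (Ioo (0 : ℝ) T ×ˢ univ)) := by
      have := Summit.AnomalousDissipation.AnomalousDissipation.Theorems.LapInventory.memLp_top_stLift_comp_const_add ha (hbd j (a + T) (by linarith))
      rwa [show a + T - a = T by ring] at this
    have hB1 := hB (ν j) T Dh (fun t => v j (a + t)) h Θ (hν j) hh hDh0 hΔ hu' hΘ
    have hL2 := hΘ.ae_memLp_two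
    -- pick a lag `s ∈ (s₀, S)` where all three a.e. statements hold
    have hsub : Ioo s₀ S ⊆ Ioo 0 T := Ioo_subset_Ioo hs₀.le hST.le
    have hall : ∀ᵐ s ∂(volume.restrict (Ioo s₀ S)), s ∈ Ioo s₀ S ∧
        (scalarL2Sq (Θ s) ≤ C * Real.exp (-(γ * s)) * L ∧
        (L - ∫ x, h x * Θ s x ≤ 2 * ν j * s * Real.sqrt L * Dh +
          2 * (∫ τ in Ioo (0 : ℝ) s, Real.sqrt (∫ x,
            (⟪v j (a + τ) x, FunctionSpaces.Torus.gradient h x⟫_ℝ) ^ 2)) ^ 2) ∧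
        MemLp (Θ s) 2 volume) := by
      have h3 := ae_restrict_of_ae_restrict_of_subset hsub (hUh.and (hB1.and hL2))
      filter_upwards [ae_restrict_mem measurableSet_Ioo, h3] with s hs h3
      exact ⟨hs, h3⟩
    haveI : (ae ((volume : Measure ℝ).restrict (Ioo s₀ S))).NeBot := by
      rw [ae_neBot, Ne, Measure.restrict_eq_zero, Real.volume_Ioo, ENNReal.ofReal_eq_zero, not_le]
      linarith
    obtain ⟨s, hs, hdec, hbal, hmem⟩ := hall.exists
    have hs0 : 0 < s := hs₀.trans hs.1
    -- decay at lag `s`: `‖Θ(s)‖² ≤ L/64`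
    have hdec' : scalarL2Sq (Θ s) ≤ L / 64 := by
      have h1 : Real.exp (-(γ * s)) ≤ Real.exp (-(γ * s₀)) :=
        Real.exp_le_exp.2 (by nlinarith [hs.1, hγ])
      have h2 : C * Real.exp (-(γ * s₀)) ≤ 1 / 64 := by
        rw [hγs₀, ← hy6]; exact pow_six_mul_exp_le hy1
      calc scalarL2Sq (Θ s) ≤ C * Real.exp (-(γ * s)) * L := hdec
        _ ≤ C * Real.exp (-(γ * s₀)) * L := by gcongr
        _ ≤ 1 / 64 * L := by gcongr
        _ = L / 64 := by ring
    -- Cauchy–Schwarz: `⟨h, Θ(s)⟩ ≤ L/8`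
    have hCS : ∫ x, h x * Θ s x ≤ L / 8 := by
      have h1 : ∫ x, h x * Θ s x ≤ Real.sqrt L * Real.sqrt (scalarL2Sq (Θ s)) :=
        integral_mul_le_sqrt_mul_sqrt_of_memLp (hh.memLp 2) hmem
      have h2 : Real.sqrt (scalarL2Sq (Θ s)) ≤ Real.sqrt L / 8 := by
        have e : Real.sqrt (L / 64) = Real.sqrt L / 8 := by
          rw [Real.sqrt_div hL.le, show (64 : ℝ) = 8 ^ 2 by norm_num, Real.sqrt_sq (by norm_num)]
        rw [← e]
        exact Real.sqrt_le_sqrt hdec'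
      calc ∫ x, h x * Θ s x ≤ Real.sqrt L * Real.sqrt (scalarL2Sq (Θ s)) := h1
        _ ≤ Real.sqrt L * (Real.sqrt L / 8) := by gcongr
        _ = L / 8 := by rw [← mul_div_assoc, Real.mul_self_sqrt hL.le]
    -- the velocity term: `(∫₀ˢ ‖v·∇h‖₂)² ≤ G² S ∫₀^S f_j(a+τ) dτ`
    have hvel : (∫ τ in Ioo (0 : ℝ) s, Real.sqrt (∫ x,
        (⟪v j (a + τ) x, FunctionSpaces.Torus.gradient h x⟫_ℝ) ^ 2)) ^ 2 ≤
        G ^ 2 * S * ∫ τ in Ioo 0 S, f j (a + τ) := by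
      have hcontS : ContinuousOn (fun τ => G * Real.sqrt (f j (a + τ))) (Icc 0 S) :=
        continuousOn_const.mul (Real.continuous_sqrt.comp_continuousOn (hfca j a ha S))
      have hintS : IntegrableOn (fun τ => G * Real.sqrt (f j (a + τ))) (Ioo 0 S) volume :=
        (hcontS.integrableOn_compact isCompact_Icc).mono_set Ioo_subset_Icc_self
      -- compare the integrands on `(0, s)`
      have h1 : ∫ τ in Ioo (0 : ℝ) s, Real.sqrt (∫ x,
          (⟪v j (a + τ) x, FunctionSpaces.Torus.gradient h x⟫_ℝ) ^ 2) ≤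
          ∫ τ in Ioo (0 : ℝ) s, G * Real.sqrt (f j (a + τ)) := by
        refine integral_mono_of_nonneg (Eventually.of_forall fun τ => Real.sqrt_nonneg _)
          (hintS.mono_set (Ioo_subset_Ioo_right hs.2.le)) ?_
        filter_upwards [ae_restrict_mem measurableSet_Ioo] with τ hτ
        exact sqrt_integral_inner_gradient_sq_le (hvL2 j (a + τ) (by linarith [hτ.1])) hG
      -- enlarge the window to `(0, S)`
      have h2 : ∫ τ in Ioo (0 : ℝ) s, G * Real.sqrt (f j (a + τ)) ≤
          ∫ τ in Ioo (0 : ℝ) S, G * Real.sqrt (f j (a + τ)) :=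
        setIntegral_mono_set hintS
          (Eventually.of_forall fun τ => mul_nonneg hG0 (Real.sqrt_nonneg _))
          (Ioo_subset_Ioo_right hs.2.le).eventuallyLE
      -- Cauchy–Schwarz in time
      have h3 : (∫ τ in Ioo (0 : ℝ) S, Real.sqrt (f j (a + τ))) ^ 2 ≤
          S * ∫ τ in Ioo 0 S, f j (a + τ) :=
        sq_setIntegral_sqrt_le hS0.le (hfca j a ha S) fun τ _ => hf0 j (a + τ)
      have h0 : 0 ≤ ∫ τ in Ioo (0 : ℝ) s, Real.sqrt (∫ x,
          (⟪v j (a + τ) x, FunctionSpaces.Torus.gradient h x⟫_ℝ) ^ 2) :=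
        integral_nonneg fun τ => Real.sqrt_nonneg _
      have h4 := h1.trans h2
      rw [integral_const_mul] at h4
      calc (∫ τ in Ioo (0 : ℝ) s, Real.sqrt (∫ x,
            (⟪v j (a + τ) x, FunctionSpaces.Torus.gradient h x⟫_ℝ) ^ 2)) ^ 2
          ≤ (G * ∫ τ in Ioo (0 : ℝ) S, Real.sqrt (f j (a + τ))) ^ 2 := pow_le_pow_left₀ h0 h4 2
        _ = G ^ 2 * (∫ τ in Ioo (0 : ℝ) S, Real.sqrt (f j (a + τ))) ^ 2 := by ring
        _ ≤ G ^ 2 * (S * ∫ τ in Ioo 0 S, f j (a + τ)) := by gcongr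
        _ = G ^ 2 * S * ∫ τ in Ioo 0 S, f j (a + τ) := by ring
    -- assemble
    have hI0 : 0 ≤ ∫ τ in Ioo 0 S, f j (a + τ) :=
      setIntegral_nonneg measurableSet_Ioo fun τ _ => hf0 j (a + τ)
    have hdiff : 2 * ν j * s * Real.sqrt L * Dh ≤ 3 * ν j * s₀ * Real.sqrt L * Dh := by
      have hsS : s ≤ S := hs.2.le
      have hK0 : 0 ≤ ν j * Real.sqrt L * Dh := mul_nonneg (mul_nonneg (hν j).le (Real.sqrt_nonneg _)) hDh0
      have h23 : 2 * s ≤ 3 * s₀ := by rw [hSdef] at hsS; linarith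
      calc 2 * ν j * s * Real.sqrt L * Dh = (2 * s) * (ν j * Real.sqrt L * Dh) := by ring
        _ ≤ (3 * s₀) * (ν j * Real.sqrt L * Dh) := mul_le_mul_of_nonneg_right h23 hK0
        _ = 3 * ν j * s₀ * Real.sqrt L * Dh := by ring
    rw [hSdef] at hvel
    linarith [hbal, hCS, hvel, hdiff]
  /- Step B: integrate Step A over the phases `a ∈ (0, R)`, `R → ∞`:
     `7L/8 ≤ 3 ν_j s₀ √L Dh + 5 G² s₀² E`. -/
  have stepB : ∀ j, 7 * L / 8 ≤ 3 * ν j * s₀ * Real.sqrt L * Dh + 5 * G ^ 2 * s₀ ^ 2 * E := by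
    intro j
    obtain ⟨T₀, hT₀⟩ := eventually_atTop.1 (hEmean j)
    set R : ℝ := max T₀ (9 * S) + 1 with hRdef
    have hR9 : 9 * S ≤ R := by rw [hRdef]; linarith [le_max_right T₀ (9 * S)]
    have hR0 : 0 < R := by linarith
    have hRT : T₀ ≤ R + S := by rw [hRdef]; linarith [le_max_left T₀ (9 * S)]
    -- the window form of Step A
    have hAW : ∀ t ∈ Icc S (R + S),
        7 * L / 8 ≤ 3 * ν j * s₀ * Real.sqrt L * Dh + 3 * G ^ 2 * s₀ * ∫ τ in (t - S)..t, f j τ := by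
      intro t ht
      have hta : 0 ≤ t - S := by linarith [ht.1]
      have hA := stepA j (t - S) hta
      have e : ∫ τ in Ioo 0 S, f j (t - S + τ) = ∫ τ in (t - S)..t, f j τ := by
        rw [← integral_Ioc_eq_integral_Ioo, ← intervalIntegral.integral_of_le hS0.le,
          intervalIntegral.integral_comp_add_left (f j) (t - S), add_zero, sub_add_cancel]
      rw [e] at hA
      exact hA
    -- integrate over `t ∈ [S, R + S]`
    have hWint : IntervalIntegrable (fun t => ∫ τ in (t - S)..t, f j τ) volume S (R + S) :=
      AgeDecoupling.intervalIntegrable_window (hfi j) hS0.le (by linarith)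
    have hmono := intervalIntegral.integral_mono_on (μ := volume) (a := S) (b := R + S)
      (f := fun _ => 7 * L / 8)
      (g := fun t => 3 * ν j * s₀ * Real.sqrt L * Dh + 3 * G ^ 2 * s₀ * ∫ τ in (t - S)..t, f j τ)
      (by linarith) intervalIntegrable_const (intervalIntegrable_const.add (hWint.const_mul _)) hAW
    have eL : ∫ _ in S..(R + S), (7 * L / 8 : ℝ) = R * (7 * L / 8) := by
      rw [intervalIntegral.integral_const, smul_eq_mul]; ring
    have eR : ∫ t in S..(R + S),
        (3 * ν j * s₀ * Real.sqrt L * Dh + 3 * G ^ 2 * s₀ * ∫ τ in (t - S)..t, f j τ) =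
        R * (3 * ν j * s₀ * Real.sqrt L * Dh) +
          3 * G ^ 2 * s₀ * ∫ t in S..(R + S), ∫ τ in (t - S)..t, f j τ := by
      rw [intervalIntegral.integral_add intervalIntegrable_const (hWint.const_mul _),
        intervalIntegral.integral_const, intervalIntegral.integral_const_mul, smul_eq_mul]
      ring
    rw [eL, eR] at hmono
    -- sliding windows: `∫_S^{R+S} W ≤ S ∫₀^{R+S} f_j ≤ S (R+S) E`
    have hwin : ∫ t in S..(R + S), (∫ τ in (t - S)..t, f j τ) ≤ S * ∫ τ in (0 : ℝ)..(R + S), f j τ :=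
      AgeDecoupling.integral_window_le (hfi j) (hf0 j) hS0.le (by linarith)
    have hmean : ∫ τ in (0 : ℝ)..(R + S), f j τ ≤ (R + S) * E := by
      have h1 := hT₀ (R + S) hRT
      have hRS0 : 0 < R + S := by linarith
      unfold timeMean at h1
      rw [inv_mul_le_iff₀ hRS0] at h1
      exact h1
    have hGs : 0 ≤ 3 * G ^ 2 * s₀ := by positivity
    have h1 : R * (7 * L / 8) ≤ R * (3 * ν j * s₀ * Real.sqrt L * Dh) +
        3 * G ^ 2 * s₀ * (S * ((R + S) * E)) := by
      have := mul_le_mul_of_nonneg_left (hwin.trans (mul_le_mul_of_nonneg_left hmean hS0.le)) hGs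
      linarith
    -- `3 S (R + S) ≤ 5 s₀ R` since `R ≥ 9 S`, `S = 3 s₀ / 2`
    have h2 : 3 * G ^ 2 * s₀ * (S * ((R + S) * E)) ≤ R * (5 * G ^ 2 * s₀ ^ 2 * E) := by
      have hSR : 3 * S * (R + S) ≤ 5 * s₀ * R := by rw [hSdef] at hR9 ⊢; nlinarith
      have hGE : 0 ≤ G ^ 2 * E := mul_nonneg (sq_nonneg G) hE0
      nlinarith [mul_le_mul_of_nonneg_left hSR (mul_nonneg hGE hs₀.le)]
    have h3 : R * (7 * L / 8) ≤ R * (3 * ν j * s₀ * Real.sqrt L * Dh + 5 * G ^ 2 * s₀ ^ 2 * E) := by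
      linarith
    exact le_of_mul_le_mul_left h3 hR0
  /- Step C: `5 G² s₀² E = 180 C^{1/3} G² E / γ²`, and `ν_j → 0`. -/
  by_contra hlt
  push Not at hlt
  have h5 : 5 * G ^ 2 * s₀ ^ 2 * E < 7 * L / 8 := by
    have e : 5 * G ^ 2 * s₀ ^ 2 * E * γ ^ 2 = 180 * (y ^ 2 * G ^ 2 * E) := by
      have : s₀ * γ = 6 * y := by rw [mul_comm]; exact hγs₀
      calc 5 * G ^ 2 * s₀ ^ 2 * E * γ ^ 2 = 5 * G ^ 2 * E * (s₀ * γ) ^ 2 := by ring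
        _ = 180 * (y ^ 2 * G ^ 2 * E) := by rw [this]; ring
    have hlt' : 1440 * y ^ 2 * G ^ 2 * E < 7 * γ ^ 2 * L := by rw [hy2]; exact hlt
    have hγ2 : 0 < γ ^ 2 := by positivity
    have key : 5 * G ^ 2 * s₀ ^ 2 * E * γ ^ 2 < 7 * L / 8 * γ ^ 2 := by
      rw [e]; linarith
    exact lt_of_mul_lt_mul_right key hγ2.le
  have hK0 : 0 < 3 * s₀ * Real.sqrt L * Dh + 1 := by positivity
  have hε : 0 < 7 * L / 8 - 5 * G ^ 2 * s₀ ^ 2 * E := by linarith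
  have hb : 0 < (7 * L / 8 - 5 * G ^ 2 * s₀ ^ 2 * E) / (3 * s₀ * Real.sqrt L * Dh + 1) := by positivity
  obtain ⟨j, hj⟩ := (hνlim.eventually (Iio_mem_nhds hb)).exists
  have hj' : ν j * (3 * s₀ * Real.sqrt L * Dh + 1) < 7 * L / 8 - 5 * G ^ 2 * s₀ ^ 2 * E := by
    have := (lt_div_iff₀ hK0).1
      (show ν j < (7 * L / 8 - 5 * G ^ 2 * s₀ ^ 2 * E) / (3 * s₀ * Real.sqrt L * Dh + 1) from hj)
    linarith
  have hB' := stepB j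
  have hν0 : 0 < ν j := hν j
  have e3 : 3 * ν j * s₀ * Real.sqrt L * Dh = ν j * (3 * s₀ * Real.sqrt L * Dh + 1) - ν j := by ring
  rw [e3] at hB'
  linarith

/-- **The fast relaxing-family class is empty (modulo B1).** Any proof of the line's
`stub_boost : RelaxingFamily → FastRelaxingFamily` is a proof of `¬ RelaxingFamily`, and
`stub_fastFloorUpgrade` has an unsatisfiable hypothesis: by `energy_floor_of_ballistic` a relaxing
family has `7 γ² ‖h‖² ≤ 1440 C^{1/3} G² E`, while FAST asks `256 C^{1/3} G² E ≤ γ² ‖h‖²`. [folklore] -/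
theorem fastRelaxingFamily_false_of_ballistic (hB : Ballistic) : ¬ FastRelaxingFamily := by
  rintro ⟨g, h, -, -, -, hh, -, hh0, ν, v₀, v, hν, hνlim, hLH, hbd, hsm, E, C, γ, G, -, hEmean,
    hC1, hγ, hG, hfast, hU⟩
  have hL : 0 < scalarL2Sq h := scalarL2Sq_pos_of_ne_zero hh hh0
  have hfloor := energy_floor_of_ballistic hB hh hh0 hν hνlim hLH hbd hsm hEmean hC1 hγ hG hU
  nlinarith [mul_pos (pow_pos hγ 2) hL]


section SlowRegime

open ProbabilityTheory Complex Literature.Analysis.FunctionSpaces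
open scoped ComplexConjugate NNReal

/-! ## 5. Slow regime: a positive-definite kernel with envelope, curvature bound and zero mass -/

/-- The slow-regime kernel `K(τ) = (1 - τ²/2) e^{-τ²/4}`. [folklore] -/
def slowKernel (τ : ℝ) : ℝ := (1 - τ ^ 2 / 2) * Real.exp (-(τ ^ 2 / 4))

/-- `K(0) = 1`. [folklore] -/
theorem slowKernel_zero : slowKernel 0 = 1 := by simp [slowKernel]

/-- `K` is even. [folklore] -/
theorem slowKernel_neg (τ : ℝ) : slowKernel (-τ) = slowKernel τ := by simp [slowKernel]

/-- `K` is continuous. [folklore] -/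
theorem continuous_slowKernel : Continuous slowKernel := by
  unfold slowKernel; fun_prop

/-- The inner exponent: `(−σ²/4)' = −σ/2`. [folklore] -/
theorem hasDerivAt_negSqDiv (s : ℝ) : HasDerivAt (fun σ : ℝ => -(σ ^ 2 / 4)) (-(s / 2)) s := by
  have h : HasDerivAt (fun σ : ℝ => -(σ ^ 2 / 4)) (-(((2 : ℕ) : ℝ) * s ^ (2 - 1) / 4)) s :=
    ((hasDerivAt_pow 2 s).div_const 4).neg
  exact h.congr_deriv (by push_cast; ring)

/-- `K` is the derivative of `τ e^{-τ²/4}`. [folklore] -/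
theorem hasDerivAt_mul_exp (τ : ℝ) :
    HasDerivAt (fun σ : ℝ => σ * Real.exp (-(σ ^ 2 / 4))) (slowKernel τ) τ := by
  have h2 : HasDerivAt (fun σ : ℝ => Real.exp (-(σ ^ 2 / 4)))
      (Real.exp (-(τ ^ 2 / 4)) * (-(τ / 2))) τ := (hasDerivAt_negSqDiv τ).exp
  have h3 : HasDerivAt (fun σ : ℝ => σ * Real.exp (-(σ ^ 2 / 4)))
      (1 * Real.exp (-(τ ^ 2 / 4)) + τ * (Real.exp (-(τ ^ 2 / 4)) * (-(τ / 2)))) τ :=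
    (hasDerivAt_id' τ).mul h2
  exact h3.congr_deriv (by simp only [slowKernel]; ring)

/-- Short-lag bound: `1 - K(τ) ≤ (3/4) τ²` (`1 - e^{-x} ≤ x`, `e^{-x} ≤ 1`). [folklore] -/
theorem one_sub_slowKernel_le (τ : ℝ) : 1 - slowKernel τ ≤ 3 * τ ^ 2 / 4 := by
  unfold slowKernel
  set x : ℝ := τ ^ 2 / 4 with hx
  have hx0 : 0 ≤ x := by positivity
  have he1 : Real.exp (-x) ≤ 1 := by rw [Real.exp_le_one_iff]; linarith
  have he2 : 1 - x ≤ Real.exp (-x) := by linarith [Real.add_one_le_exp (-x)]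
  have he0 : 0 ≤ Real.exp (-x) := (Real.exp_pos _).le
  have : τ ^ 2 / 2 = 2 * x := by rw [hx]; ring
  rw [this]
  nlinarith [mul_nonneg hx0 he0]

/-- Envelope: `|K(τ)| ≤ 15 e^{-|τ|}` (`|τ| - τ²/8 ≤ 2`, `(1 + 4w) e^{-w} ≤ 2`, `e² < 15/2`). [folklore] -/
theorem abs_slowKernel_le (τ : ℝ) : |slowKernel τ| ≤ 15 * Real.exp (-(1 * |τ|)) := by
  unfold slowKernel
  set w : ℝ := τ ^ 2 / 8 with hw
  have hw0 : 0 ≤ w := by positivity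
  have hsq : τ ^ 2 = |τ| ^ 2 := (sq_abs τ).symm
  -- `|1 - τ²/2| ≤ 1 + 4w`
  have h1 : |1 - τ ^ 2 / 2| ≤ 1 + 4 * w := by
    rw [abs_le]; constructor <;> nlinarith [sq_nonneg τ]
  -- `(1 + 4w) e^{-w} ≤ 2`
  have h2 : (1 + 4 * w) * Real.exp (-w) ≤ 2 := by
    have hexp : 1 + w + w ^ 2 / 2 ≤ Real.exp w := by
      have := Real.quadratic_le_exp_of_nonneg hw0
      linarith
    have hpos : 0 < Real.exp w := Real.exp_pos w
    rw [Real.exp_neg, ← div_eq_mul_inv, div_le_iff₀ hpos]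
    nlinarith [sq_nonneg (w - 1)]
  -- `e^{-τ²/4} = e^{-w} e^{-w}` and `e^{-w} ≤ e^{2} e^{-|τ|}`
  have h3 : Real.exp (-(τ ^ 2 / 4)) = Real.exp (-w) * Real.exp (-w) := by
    rw [← Real.exp_add]; congr 1; rw [hw]; ring
  have h4 : Real.exp (-w) ≤ Real.exp 2 * Real.exp (-(1 * |τ|)) := by
    rw [← Real.exp_add, Real.exp_le_exp]
    have : |τ| - |τ| ^ 2 / 8 ≤ 2 := by nlinarith [sq_nonneg (|τ| - 4)]
    rw [hw, hsq]; linarith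
  have h5 : Real.exp 2 ≤ 15 / 2 := by
    have := Real.exp_one_lt_d9
    have e2 : Real.exp 2 = Real.exp 1 * Real.exp 1 := by rw [← Real.exp_add]; norm_num
    rw [e2]; nlinarith [Real.exp_pos (1 : ℝ)]
  rw [abs_mul, abs_of_pos (Real.exp_pos _), h3]
  have hA : 0 ≤ Real.exp (-w) := (Real.exp_pos _).le
  have hB : 0 ≤ Real.exp (-(1 * |τ|)) := (Real.exp_pos _).le
  calc |1 - τ ^ 2 / 2| * (Real.exp (-w) * Real.exp (-w))
      = (|1 - τ ^ 2 / 2| * Real.exp (-w)) * Real.exp (-w) := by ring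
    _ ≤ ((1 + 4 * w) * Real.exp (-w)) * (Real.exp 2 * Real.exp (-(1 * |τ|))) := by
        gcongr
    _ ≤ 2 * (15 / 2 * Real.exp (-(1 * |τ|))) := by gcongr
    _ = 15 * Real.exp (-(1 * |τ|)) := by ring

/-- `K` is integrable on `ℝ`. [folklore] -/
theorem integrable_slowKernel : Integrable slowKernel :=
  Summit.AnomalousDissipation.AnomalousDissipation.Theorems.FloorUpgradeLine.CosTransformNonneg.integrable_of_abs_le_exp
    slowKernel 15 1
    continuous_slowKernel one_pos abs_slowKernel_le

/-- Zero mass on the half-line: `∫₀^∞ K = 0` (`K = (τ e^{-τ²/4})'`, which vanishes at `0` and at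
`∞`). [folklore] -/
theorem integral_Ioi_slowKernel : ∫ τ in Ioi (0 : ℝ), slowKernel τ = 0 := by
  have hlim : Tendsto (fun σ : ℝ => σ * Real.exp (-(σ ^ 2 / 4))) atTop (𝓝 0) := by
    have h0 := Real.tendsto_pow_mul_exp_neg_atTop_nhds_zero 1
    refine tendsto_of_tendsto_of_tendsto_of_le_of_le' tendsto_const_nhds h0 ?_ ?_
    · filter_upwards [eventually_ge_atTop 0] with σ hσ
      exact mul_nonneg hσ (Real.exp_pos _).le
    · filter_upwards [eventually_ge_atTop 4] with σ hσ
      rw [pow_one]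
      refine mul_le_mul_of_nonneg_left (Real.exp_le_exp.2 ?_) (by linarith)
      nlinarith
  have h := integral_Ioi_of_hasDerivAt_of_tendsto (a := 0) (m := 0)
    (f := fun σ : ℝ => σ * Real.exp (-(σ ^ 2 / 4))) (f' := slowKernel)
    (by fun_prop) (fun τ _ => hasDerivAt_mul_exp τ) integrable_slowKernel.integrableOn hlim
  simpa using h

/-! ## Positive-definiteness: `K` is the characteristic function of `2x² · N(0, 1/2)` -/

/-- The Gaussian `N(0, 1/2)` weighted by `2x²` (a finite measure of total mass `1`). [folklore] -/
def slowMeasure : Measure ℝ :=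
  (gaussianReal 0 ((1 : ℝ≥0) / 2)).withDensity fun x => ENNReal.ofReal (2 * x ^ 2)

/-- `2x² · N(0,1/2)` is a finite measure (second Gaussian moment). [folklore] -/
instance slowMeasure_isFiniteMeasure : IsFiniteMeasure slowMeasure := by
  unfold slowMeasure
  refine isFiniteMeasure_withDensity_ofReal ?_
  have h : Integrable (fun x : ℝ => 2 * x ^ 2) (gaussianReal 0 ((1 : ℝ≥0) / 2)) := by
    have h2 := (memLp_id_gaussianReal (μ := 0) (v := (1 : ℝ≥0) / 2) 2).integrable_norm_pow
      (by norm_num)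
    refine (h2.const_mul 2).congr (Eventually.of_forall fun x => ?_)
    simp [sq_abs]
  exact h.hasFiniteIntegral

/-- The characteristic function of `N(0, 1/2)` is `e^{-t²/4}`. [folklore] -/
theorem charFun_gauss_half (t : ℝ) :
    charFun (gaussianReal 0 ((1 : ℝ≥0) / 2)) t = cexp (((-(t ^ 2 / 4) : ℝ) : ℂ)) := by
  rw [charFun_gaussianReal]
  congr 1
  have hv : (((1 : ℝ≥0) / 2 : ℝ≥0) : ℝ) = 1 / 2 := by norm_num
  rw [hv]
  push_cast
  ring

/-- The second derivative of `t ↦ e^{-t²/4}` (complex-valued): `(t²/4 - 1/2) e^{-t²/4}`. [folklore] -/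
theorem iteratedDeriv_two_cexp (t : ℝ) :
    iteratedDeriv 2 (fun s : ℝ => cexp (((-(s ^ 2 / 4) : ℝ) : ℂ))) t =
      (((t ^ 2 / 4 - 1 / 2 : ℝ)) : ℂ) * cexp (((-(t ^ 2 / 4) : ℝ) : ℂ)) := by
  -- first derivative
  have hr : ∀ s : ℝ, HasDerivAt (fun σ : ℝ => -(σ ^ 2 / 4)) (-(s / 2)) s := hasDerivAt_negSqDiv
  have h1 : ∀ s : ℝ, HasDerivAt (fun σ : ℝ => cexp (((-(σ ^ 2 / 4) : ℝ) : ℂ)))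
      (cexp (((-(s ^ 2 / 4) : ℝ) : ℂ)) * (((-(s / 2) : ℝ)) : ℂ)) s := fun s =>
    ((hr s).ofReal_comp).cexp
  have hd1 : deriv (fun σ : ℝ => cexp (((-(σ ^ 2 / 4) : ℝ) : ℂ))) =
      fun s => cexp (((-(s ^ 2 / 4) : ℝ) : ℂ)) * (((-(s / 2) : ℝ)) : ℂ) :=
    funext fun s => (h1 s).deriv
  -- second derivative
  have hl : ∀ s : ℝ, HasDerivAt (fun σ : ℝ => (((-(σ / 2) : ℝ)) : ℂ)) ((((-(1 / 2 : ℝ)) : ℝ) : ℂ)) s := by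
    intro s
    have : HasDerivAt (fun σ : ℝ => -(σ / 2)) (-(1 / 2)) s := ((hasDerivAt_id' s).div_const 2).neg
    exact this.ofReal_comp
  have h2 : HasDerivAt (fun s : ℝ => cexp (((-(s ^ 2 / 4) : ℝ) : ℂ)) * (((-(s / 2) : ℝ)) : ℂ))
      (cexp (((-(t ^ 2 / 4) : ℝ) : ℂ)) * (((-(t / 2) : ℝ)) : ℂ) * (((-(t / 2) : ℝ)) : ℂ) +
        cexp (((-(t ^ 2 / 4) : ℝ) : ℂ)) * ((((-(1 / 2 : ℝ)) : ℝ) : ℂ))) t := (h1 t).mul (hl t)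
  rw [iteratedDeriv_succ, iteratedDeriv_one, hd1, h2.deriv]
  push_cast
  ring

/-- **`K` is a characteristic function**: `charFun (2x² · N(0,1/2)) = K`. [folklore] -/
theorem charFun_slowMeasure (t : ℝ) : charFun slowMeasure t = ((slowKernel t : ℝ) : ℂ) := by
  have hmem : MemLp id 2 (gaussianReal 0 ((1 : ℝ≥0) / 2)) := by
    simpa using memLp_id_gaussianReal (μ := 0) (v := (1 : ℝ≥0) / 2) 2
  -- unfold the density
  have h1 : charFun slowMeasure t =
      ∫ x, (2 * x ^ 2 : ℝ) • cexp (t * x * I) ∂(gaussianReal 0 ((1 : ℝ≥0) / 2)) := by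
    rw [charFun_apply_real, slowMeasure, integral_withDensity_eq_integral_toReal_smul (by fun_prop)
      (Eventually.of_forall fun x => ENNReal.ofReal_lt_top)]
    refine integral_congr_ae (Eventually.of_forall fun x => ?_)
    show (ENNReal.ofReal (2 * x ^ 2)).toReal • cexp (↑t * ↑x * I) = (2 * x ^ 2 : ℝ) • cexp (↑t * ↑x * I)
    rw [ENNReal.toReal_ofReal (by positivity)]
  -- the second moment integral is `-(charFun)''`
  have h2 : ∫ x, (2 * x ^ 2 : ℝ) • cexp (t * x * I) ∂(gaussianReal 0 ((1 : ℝ≥0) / 2)) =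
      2 * ∫ x, (x : ℂ) ^ 2 * cexp (t * x * I) ∂(gaussianReal 0 ((1 : ℝ≥0) / 2)) := by
    rw [← integral_const_mul]
    refine integral_congr_ae (Eventually.of_forall fun x => ?_)
    show (2 * x ^ 2 : ℝ) • cexp (↑t * ↑x * I) = 2 * ((x : ℂ) ^ 2 * cexp (↑t * ↑x * I))
    rw [real_smul]
    push_cast
    ring
  have h3 := iteratedDeriv_charFun (μ := gaussianReal 0 ((1 : ℝ≥0) / 2)) (n := 2) (t := t) hmem
  have h4 : (fun s => charFun (gaussianReal 0 ((1 : ℝ≥0) / 2)) s) =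
      fun s : ℝ => cexp (((-(s ^ 2 / 4) : ℝ) : ℂ)) := funext charFun_gauss_half
  have h5 : ∫ x, (x : ℂ) ^ 2 * cexp (t * x * I) ∂(gaussianReal 0 ((1 : ℝ≥0) / 2)) =
      -(iteratedDeriv 2 (charFun (gaussianReal 0 ((1 : ℝ≥0) / 2))) t) := by
    rw [h3, I_sq]; ring
  rw [h1, h2, h5, show (charFun (gaussianReal 0 ((1 : ℝ≥0) / 2))) =
      fun s => charFun (gaussianReal 0 ((1 : ℝ≥0) / 2)) s from rfl, h4, iteratedDeriv_two_cexp]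
  simp only [slowKernel]
  push_cast
  ring

/-- **`K` is positive-definite** in the real finite-sum sense of the line's stubs. [folklore] -/
theorem slowKernel_posDef (n : ℕ) (τ c : Fin n → ℝ) :
    0 ≤ ∑ i, ∑ j, c i * c j * slowKernel (τ i - τ j) := by
  have h := (isPositiveDefinite_charFun slowMeasure n τ (fun i => (c i : ℂ))).1
  have e : (∑ i, ∑ j, conj ((c i : ℂ)) * (c j : ℂ) * charFun slowMeasure (τ j - τ i)).re =
      ∑ i, ∑ j, c i * c j * slowKernel (τ i - τ j) := by
    rw [Complex.re_sum]
    refine Finset.sum_congr rfl fun i _ => ?_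
    rw [Complex.re_sum]
    refine Finset.sum_congr rfl fun j _ => ?_
    rw [charFun_slowMeasure, Complex.conj_ofReal, show τ j - τ i = -(τ i - τ j) by ring,
      slowKernel_neg]
    norm_cast
  rwa [e] at h

/-! ### The slow-regime theorems -/

/-- **A positive-definite kernel with envelope, curvature bound and ZERO zero-frequency mass.**
There is an even continuous `K`, positive-definite in the finite-sum sense, with `K(0) = 1`,
`|K(τ)| ≤ 15 e^{-|τ|}`, `K(0) - K(τ) ≤ 0·|τ| + K(0)·(3/2)·τ²/2`, and `∫₀^∞ K = 0`. [folklore] -/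
theorem exists_pd_kernel_zero_mass : ∃ K : ℝ → ℝ, Continuous K ∧ (∀ τ, K (-τ) = K τ) ∧ K 0 = 1 ∧
    (∀ τ, |K τ| ≤ 15 * Real.exp (-(1 * |τ|))) ∧
    (∀ τ, K 0 - K τ ≤ 0 * |τ| + K 0 * Real.sqrt (3 / 2) ^ 2 * τ ^ 2 / 2) ∧
    (∀ (n : ℕ) (τ c : Fin n → ℝ), 0 ≤ ∑ i, ∑ j, c i * c j * K (τ i - τ j)) ∧
    ∫ τ in Ioi (0 : ℝ), K τ = 0 := by
  refine ⟨slowKernel, continuous_slowKernel, slowKernel_neg, slowKernel_zero, abs_slowKernel_le,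
    fun τ => ?_, slowKernel_posDef, integral_Ioi_slowKernel⟩
  rw [slowKernel_zero, Real.sq_sqrt (by norm_num)]
  have := one_sub_slowKernel_le τ
  linarith

/-- **In the slow regime the zero-frequency floor fails**: the statement of the line's
`zeroFrequencyFloor` (stubs A1–A4 composed) with the single hypothesis
`hfast : 4 (A / C 0)^{1/3} Λ ≤ γ` deleted is FALSE — witnessed by `slowKernel` with `A = 15`, `γ = 1`,
`Λ = √(3/2)`, `δ = 0`, whose zero-frequency mass vanishes. So `hfast` is load-bearing, and by Part I
(`fastRelaxingFamily_false_of_ballistic`) it is never met by a relaxing family: positive-definiteness +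
`(U_h)`-envelope + energy-curvature cannot floor the absorbed power. [folklore] -/
theorem zeroFrequencyFloor_false_without_fast :
    ¬ ∀ (C : ℝ → ℝ) (A γ Λ δ : ℝ), Continuous C → 0 < γ → 0 < Λ → 0 < C 0 → C 0 ≤ A → 0 ≤ δ →
      δ ≤ C 0 * Λ / 6 → (∀ τ, C (-τ) = C τ) → (∀ τ, |C τ| ≤ A * Real.exp (-(γ * |τ|))) →
      (∀ τ, C 0 - C τ ≤ δ * |τ| + C 0 * Λ ^ 2 * τ ^ 2 / 2) →
      (∀ (n : ℕ) (τ c : Fin n → ℝ), 0 ≤ ∑ i, ∑ j, c i * c j * C (τ i - τ j)) →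
      C 0 / (8 * Λ) ≤ ∫ τ in Ioi (0 : ℝ), C τ := by
  intro H
  have hΛ : 0 < Real.sqrt (3 / 2) := Real.sqrt_pos.2 (by norm_num)
  have h := H slowKernel 15 1 (Real.sqrt (3 / 2)) 0 continuous_slowKernel one_pos hΛ
    (by rw [slowKernel_zero]; norm_num) (by rw [slowKernel_zero]; norm_num) le_rfl
    (by rw [slowKernel_zero]; positivity) slowKernel_neg abs_slowKernel_le
    (fun τ => by
      rw [slowKernel_zero, Real.sq_sqrt (by norm_num)]
      have := one_sub_slowKernel_le τ
      linarith)
    slowKernel_posDef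
  rw [integral_Ioi_slowKernel, slowKernel_zero] at h
  have : (0 : ℝ) < 1 / (8 * Real.sqrt (3 / 2)) := by positivity
  linarith

end SlowRegime


section Ballistic

variable {d : Type*} [Fintype d]

/-! ## 6. B1 (the lead's `stub_ballistic`) PROVED, general dimension — the speed limit is unconditional -/

/-- `x ≤ a + √(2x)·F` with `a, F ≥ 0` forces `x ≤ 2a + 2F²` (`√(2x) F ≤ x/2 + F²`). [folklore] -/
theorem le_two_mul_add_of_le_add_sqrt_mul {x a F : ℝ} (ha : 0 ≤ a)
    (h : x ≤ a + Real.sqrt (2 * x) * F) : x ≤ 2 * a + 2 * F ^ 2 := by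
  rcases le_or_gt x 0 with hx | hx
  · nlinarith [sq_nonneg F]
  · have hs : Real.sqrt (2 * x) * F ≤ x / 2 + F ^ 2 := by
      have h2x : 0 ≤ 2 * x := by linarith
      nlinarith [Real.sq_sqrt h2x, sq_nonneg (Real.sqrt (2 * x) - 2 * F), Real.sqrt_nonneg (2 * x)]
    linarith

/-- The expansion `‖θ - h‖² = ‖θ‖² - 2⟨h, θ⟩ + ‖h‖²` for `L²` slices. [folklore] -/
theorem integral_sub_sq_eq {θ h : UnitAddTorus d → ℝ} (hθ : MemLp θ 2 volume) (hh : MemLp h 2 volume) :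
    ∫ x, (h x - θ x) ^ 2 = scalarL2Sq θ - 2 * (∫ x, h x * θ x) + scalarL2Sq h := by
  have i1 : Integrable (fun x => θ x ^ 2) volume := hθ.integrable_sq
  have i2 : Integrable (fun x => h x ^ 2) volume := hh.integrable_sq
  have i3 : Integrable (fun x => h x * θ x) volume := memLp_one_iff_integrable.1 (hθ.mul' hh)
  have e : (fun x => (h x - θ x) ^ 2) = fun x => θ x ^ 2 - 2 * (h x * θ x) + h x ^ 2 := by
    funext x; ring
  have i4 : Integrable (fun x => θ x ^ 2 - 2 * (h x * θ x)) volume := i1.sub (i3.const_mul 2)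
  rw [e, integral_add i4 i2, integral_sub i1 (i3.const_mul 2), integral_const_mul]
  unfold scalarL2Sq
  ring

/-! ### The ballistic bound -/

/-- Product-measure form of the essential bound of the drift. [folklore] -/
theorem ae_prod_norm_le_of_memLp_top_stLift {u : ℝ → UnitAddTorus d → EuclideanSpace ℝ d} {T : ℝ}
    (hu : MemLp (FunctionSpaces.Torus.stLift u) ∞ (volume.restrict (Ioo 0 T ×ˢ univ))) :
    ∃ C : ℝ, 0 ≤ C ∧ ∀ᵐ q : ℝ × UnitAddTorus d ∂(((volume : Measure ℝ).restrict (Ioo 0 T)).prod volume),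
      ‖u q.1 q.2‖ ≤ C := by
  set μ' : Measure (ℝ × EuclideanSpace ℝ d) := volume.restrict (Ioo 0 T ×ˢ univ) with hμ'
  set C : ℝ := (eLpNorm (FunctionSpaces.Torus.stLift u) ∞ μ').toReal with hC
  have hfin : eLpNorm (FunctionSpaces.Torus.stLift u) ∞ μ' < (⊤ : ℝ≥0∞) := hu.eLpNorm_lt_top
  have hae' : ∀ᵐ p ∂μ', ‖FunctionSpaces.Torus.stLift u p‖ ≤ C := by
    filter_upwards [ae_le_eLpNormEssSup (f := FunctionSpaces.Torus.stLift u) (μ := μ')] with p hp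
    rw [← eLpNorm_exponent_top] at hp
    have := ENNReal.toReal_mono hfin.ne hp
    rwa [toReal_enorm] at this
  refine ⟨C, ENNReal.toReal_nonneg, ?_⟩
  have hprod : μ' = ((volume : Measure ℝ).restrict (Ioo 0 T)).prod volume := by
    rw [hμ', Measure.volume_eq_prod, ← Measure.prod_restrict, Measure.restrict_univ]
  rw [hprod] at hae'
  have hq := MeasureTheory.QuasiMeasurePreserving.prodMap
    (Measure.QuasiMeasurePreserving.id ((volume : Measure ℝ).restrict (Ioo 0 T)))
    (FunctionSpaces.Torus.quasiMeasurePreserving_repr (d := d))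
  filter_upwards [hq.ae hae'] with q hq'
  simpa [FunctionSpaces.Torus.stLift] using hq'

set_option maxHeartbeats 800000 in
/-- **The ballistic short-lag bound (B1; the lead's `stub_ballistic`, general dimension).**
For `κ > 0`, a smooth profile `h` with `‖Δh‖₂ ≤ Dh`, an essentially bounded drift `u` on
`(0,T) × T^d` and a weak solution `θ` of `∂ₜθ + u·∇θ = κΔθ`, `θ(0) = h` on `[0,T)`:
`‖h‖² - ⟨h, θ(s)⟩ ≤ 2κ s ‖h‖ Dh + 2 (∫₀ˢ ‖u(τ)·∇h‖₂ dτ)²` for a.e. `s ∈ (0,T)`. [folklore] -/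
theorem ballistic_bound (κ T Dh : ℝ) (u : ℝ → UnitAddTorus d → EuclideanSpace ℝ d)
    (h : UnitAddTorus d → ℝ) (θ : ℝ → UnitAddTorus d → ℝ) (hκ : 0 < κ)
    (hh : FunctionSpaces.Torus.IsSmooth h) (hDh : 0 ≤ Dh)
    (hΔ : scalarL2Sq (FunctionSpaces.Torus.laplacian h) ≤ Dh ^ 2)
    (hu : MemLp (FunctionSpaces.Torus.stLift u) ⊤ (volume.restrict (Ioo (0 : ℝ) T ×ˢ univ)))
    (hθ : IsWeakScalarTransportOn T κ u h θ) :
    ∀ᵐ s ∂(volume.restrict (Ioo (0 : ℝ) T)),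
      scalarL2Sq h - ∫ x, h x * θ s x ≤
        2 * κ * s * Real.sqrt (scalarL2Sq h) * Dh +
        2 * (∫ τ in Ioo (0 : ℝ) s, Real.sqrt (∫ x,
              (⟪u τ x, FunctionSpaces.Torus.gradient h x⟫_ℝ) ^ 2)) ^ 2 := by
  -- notation
  set L : ℝ := scalarL2Sq h with hLdef
  have hL0 : 0 ≤ L := scalarL2Sq_nonneg h
  set k : ℝ → ℝ := fun τ => Real.sqrt (∫ x, (⟪u τ x, FunctionSpaces.Torus.gradient h x⟫_ℝ) ^ 2)
    with hkdef
  have hk0 : ∀ τ, 0 ≤ k τ := fun τ => Real.sqrt_nonneg _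
  set m : ℝ → ℝ := fun s => L - ∫ x, h x * θ s x with hmdef
  set Φ : ℝ → ℝ := fun τ => ∫ x, θ τ x *
    (⟪u τ x, FunctionSpaces.Torus.gradient h x⟫_ℝ + κ * FunctionSpaces.Torus.laplacian h x) with hΦdef
  set μT : Measure ℝ := (volume : Measure ℝ).restrict (Ioo 0 T) with hμT
  have hhL2 : MemLp h 2 volume := hh.memLp 2
  have hΔL2 : MemLp (FunctionSpaces.Torus.laplacian h) 2 volume := hh.laplacian.memLp 2
  obtain ⟨G, hG⟩ := FunctionSpaces.Torus.exists_forall_norm_le_of_continuous hh.gradient.continuous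
  have hG0 : 0 ≤ G := (norm_nonneg _).trans (hG 0)
  obtain ⟨M, hM0, hM⟩ := ae_prod_norm_le_of_memLp_top_stLift hu
  have hMslice : ∀ᵐ τ ∂μT, ∀ᵐ x ∂volume, ‖u τ x‖ ≤ M := Measure.ae_ae_of_ae_prod hM
  /- Step 1: the identity `m s = -∫_{(0,s]} Φ` for a.e. `s`. -/
  have hid : ∀ᵐ s ∂μT, m s = -∫ τ in Ioc 0 s, Φ τ := by
    filter_upwards [hθ.ae_integral_mul_eq hh] with s hs
    have e1 : ∫ x, h x * θ s x = ∫ x, θ s x * h x :=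
      integral_congr_ae (Eventually.of_forall fun x => mul_comm _ _)
    have e2 : ∫ x, h x * h x = L := by
      rw [hLdef]; unfold scalarL2Sq
      exact integral_congr_ae (Eventually.of_forall fun x => by ring)
    simp only [hmdef, hΦdef]
    rw [e1, hs, e2]
    ring
  /- Step 2: pointwise bound `-Φ τ ≤ κ √L Dh + √(2 m τ) k τ` and `0 ≤ m τ` for a.e. `τ`. -/
  have hcontr := Summit.AnomalousDissipation.AnomalousDissipation.Theorems.KinematicSteadySourceLaw.ae_scalarL2Sq_le
    hκ hθ hhL2 hu
  have hint1 := (hθ.integrable_mul_inner_continuous hh.gradient.continuous).prod_right_ae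
  have hint2 := (hθ.integrable_mul_continuous
    (c := fun x => κ * FunctionSpaces.Torus.laplacian h x)
    (continuous_const.mul hh.laplacian.continuous)).prod_right_ae
  have hpt : ∀ᵐ τ ∂μT, -Φ τ ≤ κ * Real.sqrt L * Dh + Real.sqrt (2 * m τ) * k τ ∧ 0 ≤ m τ := by
    filter_upwards [hθ.ae_memLp_two, hcontr, hθ.ae_isWeaklyDivFree,
      hθ.ae_aestronglyMeasurable_velocity_slice, hMslice, hint1, hint2]
      with τ hmem hcon hdiv husm huM hi1 hi2
    -- the slice `w = u(τ)·∇h` is in `L²`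
    set w : UnitAddTorus d → ℝ := fun x => ⟪u τ x, FunctionSpaces.Torus.gradient h x⟫_ℝ with hw
    have hwm : AEStronglyMeasurable w volume :=
      husm.inner hh.gradient.continuous.aestronglyMeasurable
    have hwbd : ∀ᵐ x ∂volume, ‖w x‖ ≤ M * G := by
      filter_upwards [huM] with x hx
      calc ‖w x‖ ≤ ‖u τ x‖ * ‖FunctionSpaces.Torus.gradient h x‖ := norm_inner_le_norm _ _
        _ ≤ M * G := mul_le_mul hx (hG x) (norm_nonneg _) hM0
    have hwL2 : MemLp w 2 volume := (memLp_top_of_bound hwm (M * G) hwbd).mono_exponent le_top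
    -- `∫ (h - θ τ)² ≤ 2 m τ`
    have hsubL2 : MemLp (fun x => h x - θ τ x) 2 volume := hhL2.sub hmem
    have hCS0 : ∫ x, h x * θ τ x ≤ Real.sqrt L * Real.sqrt (scalarL2Sq (θ τ)) :=
      integral_mul_le_sqrt_mul_sqrt_of_memLp hhL2 hmem
    have hsq : ∫ x, (h x - θ τ x) ^ 2 ≤ 2 * m τ := by
      have hcon' : scalarL2Sq (θ τ) ≤ L := by rw [hLdef]; exact hcon
      have e := integral_sub_sq_eq hmem hhL2
      rw [← hLdef] at e
      have em : m τ = L - ∫ x, h x * θ τ x := rfl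
      rw [e, em]
      linarith
    have hm0 : 0 ≤ m τ := by
      have : 0 ≤ ∫ x, (h x - θ τ x) ^ 2 := integral_nonneg fun x => sq_nonneg _
      linarith
    -- the transport term
    have hcancel : ∫ x, h x * w x = 0 := integral_mul_inner_gradient_eq_zero hh hdiv
    have hi3 : Integrable (fun x => h x * w x) volume := memLp_one_iff_integrable.1 (hwL2.mul' hhL2)
    have hi4 : Integrable (fun x => θ τ x * w x) volume := memLp_one_iff_integrable.1 (hwL2.mul' hmem)
    have htrans : -∫ x, θ τ x * w x ≤ Real.sqrt (2 * m τ) * k τ := by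
      have e : -∫ x, θ τ x * w x = ∫ x, (h x - θ τ x) * w x := by
        have : (fun x => (h x - θ τ x) * w x) = fun x => h x * w x - θ τ x * w x := by
          funext x; ring
        rw [this, integral_sub hi3 hi4, hcancel]
        ring
      rw [e]
      have hcs := integral_mul_le_sqrt_mul_sqrt_of_memLp hsubL2 hwL2
      calc ∫ x, (h x - θ τ x) * w x
          ≤ Real.sqrt (∫ x, (h x - θ τ x) ^ 2) * Real.sqrt (∫ x, w x ^ 2) := hcs
        _ ≤ Real.sqrt (2 * m τ) * k τ := by
            have h1 : Real.sqrt (∫ x, (h x - θ τ x) ^ 2) ≤ Real.sqrt (2 * m τ) := Real.sqrt_le_sqrt hsq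
            have h2 : Real.sqrt (∫ x, w x ^ 2) = k τ := rfl
            rw [h2]
            exact mul_le_mul_of_nonneg_right h1 (hk0 τ)
    -- the viscous term
    have hvisc : -(∫ x, θ τ x * (κ * FunctionSpaces.Torus.laplacian h x)) ≤ κ * Real.sqrt L * Dh := by
      have e : ∫ x, θ τ x * (κ * FunctionSpaces.Torus.laplacian h x) =
          κ * ∫ x, -θ τ x * -FunctionSpaces.Torus.laplacian h x := by
        rw [← integral_const_mul]
        exact integral_congr_ae (Eventually.of_forall fun x => by ring)
      have hnegθ : MemLp (fun x => -θ τ x) 2 volume := hmem.neg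
      have hcs := integral_mul_le_sqrt_mul_sqrt_of_memLp hnegθ hΔL2
      have h1 : Real.sqrt (∫ x, (-θ τ x) ^ 2) ≤ Real.sqrt L := by
        refine Real.sqrt_le_sqrt ?_
        have : (fun x => (-θ τ x) ^ 2) = fun x => θ τ x ^ 2 := by funext x; ring
        rw [this]; exact hcon
      have h2 : Real.sqrt (∫ x, FunctionSpaces.Torus.laplacian h x ^ 2) ≤ Dh := by
        calc Real.sqrt (∫ x, FunctionSpaces.Torus.laplacian h x ^ 2) ≤ Real.sqrt (Dh ^ 2) :=
              Real.sqrt_le_sqrt hΔ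
          _ = Dh := Real.sqrt_sq hDh
      have e2 : -(∫ x, θ τ x * (κ * FunctionSpaces.Torus.laplacian h x)) =
          κ * ∫ x, (-θ τ x) * FunctionSpaces.Torus.laplacian h x := by
        rw [e, ← mul_neg, ← integral_neg]
        congr 1
        exact integral_congr_ae (Eventually.of_forall fun x => by ring)
      rw [e2, mul_assoc]
      refine mul_le_mul_of_nonneg_left ?_ hκ.le
      calc ∫ x, (-θ τ x) * FunctionSpaces.Torus.laplacian h x
          ≤ Real.sqrt (∫ x, (-θ τ x) ^ 2) * Real.sqrt (∫ x, FunctionSpaces.Torus.laplacian h x ^ 2) := hcs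
        _ ≤ Real.sqrt L * Dh := mul_le_mul h1 h2 (Real.sqrt_nonneg _) (Real.sqrt_nonneg _)
    -- assemble
    refine ⟨?_, hm0⟩
    have esplit : Φ τ = (∫ x, θ τ x * w x) + ∫ x, θ τ x * (κ * FunctionSpaces.Torus.laplacian h x) := by
      simp only [hΦdef, hw]
      rw [← integral_add hi1 hi2]
      exact integral_congr_ae (Eventually.of_forall fun x => by ring)
    rw [esplit]
    linarith
  /- Step 3: integrate — `m s ≤ Ψ s := κ √L Dh s + ∫_{(0,s]} √(2 m) k` for a.e. `s`. -/
  -- integrability of `Φ`, `k`, and of the comparison integrand on `(0,T)`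
  have hΦint : Integrable Φ μT := (hθ.integrable_mul_steadyFlux hh).integral_prod_left
  have hFprod : Integrable (fun q : ℝ × UnitAddTorus d =>
      (⟪u q.1 q.2, FunctionSpaces.Torus.gradient h q.2⟫_ℝ) ^ 2) (μT.prod volume) := by
    have hm1 : AEStronglyMeasurable (fun q : ℝ × UnitAddTorus d =>
        (⟪u q.1 q.2, FunctionSpaces.Torus.gradient h q.2⟫_ℝ) ^ 2) (μT.prod volume) :=
      (hθ.aestronglyMeasurable_uncurry_velocity.inner
        (hh.gradient.continuous.comp continuous_snd).aestronglyMeasurable).pow 2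
    haveI : IsFiniteMeasure μT := ⟨by
      rw [hμT, Measure.restrict_apply_univ]; exact measure_Ioo_lt_top⟩
    refine ⟨hm1, (hasFiniteIntegral_const ((M * G) ^ 2)).mono ?_⟩
    filter_upwards [hM] with q hq
    rw [Real.norm_eq_abs, abs_of_nonneg (sq_nonneg _), Real.norm_eq_abs, abs_of_nonneg (sq_nonneg _)]
    have h1 : |⟪u q.1 q.2, FunctionSpaces.Torus.gradient h q.2⟫_ℝ| ≤ M * G :=
      (abs_real_inner_le_norm _ _).trans (mul_le_mul hq (hG _) (norm_nonneg _) hM0)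
    calc (⟪u q.1 q.2, FunctionSpaces.Torus.gradient h q.2⟫_ℝ) ^ 2
        = |⟪u q.1 q.2, FunctionSpaces.Torus.gradient h q.2⟫_ℝ| ^ 2 := (sq_abs _).symm
      _ ≤ (M * G) ^ 2 := pow_le_pow_left₀ (abs_nonneg _) h1 2
  have hk_meas : AEStronglyMeasurable k μT :=
    Real.continuous_sqrt.comp_aestronglyMeasurable hFprod.integral_prod_left.aestronglyMeasurable
  have hk_bd : ∀ᵐ τ ∂μT, k τ ≤ M * G := by
    filter_upwards [Measure.ae_ae_of_ae_prod hM] with τ hτ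
    have h1 : ∫ x, (⟪u τ x, FunctionSpaces.Torus.gradient h x⟫_ℝ) ^ 2 ≤
        ∫ _x : UnitAddTorus d, (M * G) ^ 2 := by
      refine integral_mono_of_nonneg (Eventually.of_forall fun x => sq_nonneg _) (integrable_const _) ?_
      filter_upwards [hτ] with x hx
      have h1 : |⟪u τ x, FunctionSpaces.Torus.gradient h x⟫_ℝ| ≤ M * G :=
        (abs_real_inner_le_norm _ _).trans (mul_le_mul hx (hG _) (norm_nonneg _) hM0)
      calc (⟪u τ x, FunctionSpaces.Torus.gradient h x⟫_ℝ) ^ 2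
          = |⟪u τ x, FunctionSpaces.Torus.gradient h x⟫_ℝ| ^ 2 := (sq_abs _).symm
        _ ≤ (M * G) ^ 2 := pow_le_pow_left₀ (abs_nonneg _) h1 2
    rw [integral_const, smul_eq_mul, measureReal_def, measure_univ, ENNReal.toReal_one, one_mul] at h1
    calc k τ = Real.sqrt (∫ x, (⟪u τ x, FunctionSpaces.Torus.gradient h x⟫_ℝ) ^ 2) := rfl
      _ ≤ Real.sqrt ((M * G) ^ 2) := Real.sqrt_le_sqrt h1
      _ = M * G := Real.sqrt_sq (mul_nonneg hM0 hG0)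
  haveI hμTfin : IsFiniteMeasure μT := ⟨by
    rw [hμT, Measure.restrict_apply_univ]; exact measure_Ioo_lt_top⟩
  have hk_int : Integrable k μT := by
    refine ⟨hk_meas, (hasFiniteIntegral_const (M * G)).mono ?_⟩
    filter_upwards [hk_bd] with τ hτ
    rw [Real.norm_eq_abs, abs_of_nonneg (hk0 τ), Real.norm_eq_abs, abs_of_nonneg (mul_nonneg hM0 hG0)]
    exact hτ
  -- the comparison integrand `q τ = √(2 m τ) k τ`
  set q : ℝ → ℝ := fun τ => Real.sqrt (2 * m τ) * k τ with hqdef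
  have hq0 : ∀ τ, 0 ≤ q τ := fun τ => mul_nonneg (Real.sqrt_nonneg _) (hk0 τ)
  have hm_meas : AEStronglyMeasurable m μT := by
    have h1 : Integrable (fun t => ∫ x, θ t x * h x) μT :=
      (hθ.integrable_mul_continuous hh.continuous).integral_prod_left
    have h2 : (fun t => ∫ x, h x * θ t x) = fun t => ∫ x, θ t x * h x := by
      funext t; exact integral_congr_ae (Eventually.of_forall fun x => mul_comm _ _)
    have h3 : AEStronglyMeasurable (fun t => ∫ x, h x * θ t x) μT := by
      rw [h2]; exact h1.aestronglyMeasurable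
    exact aestronglyMeasurable_const.sub h3
  have hm_bd : ∀ᵐ τ ∂μT, m τ ≤ 2 * L := by
    filter_upwards [hθ.ae_memLp_two, hcontr] with τ hmem hcon
    have hcs := integral_mul_le_sqrt_mul_sqrt_of_memLp hmem.neg hhL2
    have h1 : Real.sqrt (∫ x, (-θ τ x) ^ 2) ≤ Real.sqrt L := by
      refine Real.sqrt_le_sqrt ?_
      have : (fun x => (-θ τ x) ^ 2) = fun x => θ τ x ^ 2 := by funext x; ring
      rw [this]; exact hcon
    have e : -(∫ x, h x * θ τ x) = ∫ x, (-θ τ x) * h x := by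
      rw [← integral_neg]
      exact integral_congr_ae (Eventually.of_forall fun x => by ring)
    have h2 : ∫ x, (-θ τ x) * h x ≤ Real.sqrt L * Real.sqrt L :=
      hcs.trans (mul_le_mul h1 le_rfl (Real.sqrt_nonneg _) (Real.sqrt_nonneg _))
    rw [Real.mul_self_sqrt hL0] at h2
    simp only [hmdef]
    linarith
  have hq_int : Integrable q μT := by
    have hqm : AEStronglyMeasurable q μT :=
      (Real.continuous_sqrt.comp_aestronglyMeasurable (hm_meas.const_mul 2)).mul hk_meas
    refine ⟨hqm, (hasFiniteIntegral_const (Real.sqrt (2 * (2 * L)) * (M * G))).mono ?_⟩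
    filter_upwards [hm_bd, hk_bd] with τ hmτ hkτ
    rw [Real.norm_eq_abs, abs_of_nonneg (hq0 τ), Real.norm_eq_abs,
      abs_of_nonneg (mul_nonneg (Real.sqrt_nonneg _) (mul_nonneg hM0 hG0))]
    exact mul_le_mul (Real.sqrt_le_sqrt (by linarith)) hkτ (hk0 τ) (Real.sqrt_nonneg _)
  -- `Ψ` and the integrated inequality
  set Ψ : ℝ → ℝ := fun s => κ * Real.sqrt L * Dh * s + ∫ τ in Ioc 0 s, q τ ∂μT with hΨdef
  have hstep3 : ∀ᵐ s ∂μT, m s ≤ Ψ s := by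
    filter_upwards [hid, ae_restrict_mem measurableSet_Ioo] with s hs hsT
    have hs0 : 0 < s := hsT.1
    rw [hs]
    have hsub : ∀ᵐ τ ∂(μT.restrict (Ioc 0 s)), -Φ τ ≤ κ * Real.sqrt L * Dh + q τ :=
      ae_restrict_of_ae (hpt.mono fun τ hτ => hτ.1)
    have h1 : ∫ τ in Ioc 0 s, -Φ τ ∂μT ≤ ∫ τ in Ioc 0 s, (κ * Real.sqrt L * Dh + q τ) ∂μT :=
      integral_mono_ae hΦint.neg.integrableOn ((integrable_const _).add hq_int).integrableOn hsub
    rw [integral_neg] at h1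
    have h2 : ∫ τ in Ioc 0 s, (κ * Real.sqrt L * Dh + q τ) ∂μT =
        κ * Real.sqrt L * Dh * μT.real (Ioc 0 s) + ∫ τ in Ioc 0 s, q τ ∂μT := by
      rw [integral_add (integrable_const _) hq_int.integrableOn, setIntegral_const, smul_eq_mul]
      ring
    have h3 : μT.real (Ioc 0 s) ≤ s := by
      rw [measureReal_def, hμT, Measure.restrict_apply measurableSet_Ioc]
      calc (volume (Ioc 0 s ∩ Ioo 0 T)).toReal ≤ (volume (Ioc (0 : ℝ) s)).toReal := by
            refine ENNReal.toReal_mono measure_Ioc_lt_top.ne (measure_mono inter_subset_left)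
        _ = s := by rw [Real.volume_Ioc, ENNReal.toReal_ofReal (by linarith), sub_zero]
    have h4 : 0 ≤ κ * Real.sqrt L * Dh := by positivity
    calc -∫ τ in Ioc 0 s, Φ τ ≤ κ * Real.sqrt L * Dh * μT.real (Ioc 0 s) + ∫ τ in Ioc 0 s, q τ ∂μT := by
          have : -∫ τ in Ioc 0 s, Φ τ = -∫ τ in Ioc 0 s, Φ τ ∂μT := by
            rw [hμT, Measure.restrict_restrict measurableSet_Ioc,
              inter_eq_self_of_subset_left (Ioc_subset_Ioo_right hsT.2 |>.trans subset_rfl)]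
          rw [this]; linarith
      _ ≤ Ψ s := by
          simp only [hΨdef]
          nlinarith [mul_le_mul_of_nonneg_left h3 h4]
  /- Step 4: `Ψ` is monotone, so `Ψ s ≤ 2 κ √L Dh s + 2 (∫_{(0,s]} k)²` for every `s ∈ (0,T)`. -/
  have hΨmono : ∀ {τ s : ℝ}, τ ≤ s → 0 ≤ τ → Ψ τ ≤ Ψ s := by
    intro τ s hτs hτ0
    simp only [hΨdef]
    have h1 : ∫ σ in Ioc 0 τ, q σ ∂μT ≤ ∫ σ in Ioc 0 s, q σ ∂μT :=
      setIntegral_mono_set hq_int.integrableOn (Eventually.of_forall hq0)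
        (Ioc_subset_Ioc_right hτs).eventuallyLE
    have h4 : 0 ≤ κ * Real.sqrt L * Dh := by positivity
    nlinarith [mul_le_mul_of_nonneg_left hτs h4]
  have hstep4 : ∀ s ∈ Ioo 0 T, Ψ s ≤ 2 * (κ * Real.sqrt L * Dh * s) + 2 * (∫ τ in Ioc 0 s, k τ ∂μT) ^ 2 := by
    intro s hs
    have hs0 : 0 < s := hs.1
    -- `∫_{(0,s]} q ≤ √(2 Ψ s) ∫_{(0,s]} k`
    have hae : ∀ᵐ τ ∂(μT.restrict (Ioc 0 s)), q τ ≤ Real.sqrt (2 * Ψ s) * k τ := by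
      have h1 : ∀ᵐ τ ∂(μT.restrict (Ioc 0 s)), m τ ≤ Ψ τ := ae_restrict_of_ae hstep3
      filter_upwards [h1, ae_restrict_mem measurableSet_Ioc] with τ hτ hτs
      have hΨτ : Ψ τ ≤ Ψ s := hΨmono hτs.2 hτs.1.le
      have : Real.sqrt (2 * m τ) ≤ Real.sqrt (2 * Ψ s) := Real.sqrt_le_sqrt (by linarith)
      exact mul_le_mul_of_nonneg_right this (hk0 τ)
    have hI : ∫ τ in Ioc 0 s, q τ ∂μT ≤ Real.sqrt (2 * Ψ s) * ∫ τ in Ioc 0 s, k τ ∂μT := by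
      rw [← integral_const_mul]
      exact integral_mono_ae hq_int.integrableOn (hk_int.const_mul _).integrableOn hae
    have hF0 : 0 ≤ ∫ τ in Ioc 0 s, k τ ∂μT := integral_nonneg fun τ => hk0 τ
    have ha0 : 0 ≤ κ * Real.sqrt L * Dh * s := by positivity
    have hΨle : Ψ s ≤ κ * Real.sqrt L * Dh * s + Real.sqrt (2 * Ψ s) * ∫ τ in Ioc 0 s, k τ ∂μT := by
      simp only [hΨdef] at hI ⊢
      linarith
    exact le_two_mul_add_of_le_add_sqrt_mul ha0 hΨle
  /- Conclusion. -/
  filter_upwards [hstep3, ae_restrict_mem measurableSet_Ioo] with s hs hsT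
  have h4 := hstep4 s hsT
  have e : ∫ τ in Ioc 0 s, k τ ∂μT = ∫ τ in Ioo (0 : ℝ) s, k τ := by
    rw [hμT, Measure.restrict_restrict measurableSet_Ioc,
      inter_eq_self_of_subset_left (Ioc_subset_Ioo_right hsT.2), integral_Ioc_eq_integral_Ioo]
  rw [e] at h4
  simp only [hmdef] at hs
  calc scalarL2Sq h - ∫ x, h x * θ s x = m s := rfl
    _ ≤ Ψ s := hs
    _ ≤ 2 * (κ * Real.sqrt L * Dh * s) + 2 * (∫ τ in Ioo (0 : ℝ) s, k τ) ^ 2 := h4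
    _ = 2 * κ * s * Real.sqrt (scalarL2Sq h) * Dh + 2 * (∫ τ in Ioo (0 : ℝ) s, k τ) ^ 2 := by
        rw [hLdef]; ring

end Ballistic

/-! ## 7. Unconditional corollaries -/

/-- B1 holds (§6). [folklore] -/
theorem ballistic : Ballistic := fun κ T Dh u h θ => ballistic_bound κ T Dh u h θ

/-- **The FAST class of the picked line is EMPTY — unconditionally.** [folklore] -/
theorem fastRelaxingFamily_false : ¬ FastRelaxingFamily :=
  fastRelaxingFamily_false_of_ballistic ballistic

/-- `stub_boost` of the picked line is now EQUIVALENT to refuting the route's analytic heart r3. [folklore] -/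
theorem boost_iff_not_relaxingFamily : (RelaxingFamily → FastRelaxingFamily) ↔ ¬ RelaxingFamily :=
  ⟨fun hb hR => fastRelaxingFamily_false (hb hR), fun hn hR => (hn hR).elim⟩

/-- `stub_fastFloorUpgrade` of the picked line is VACUOUSLY true (its hypothesis class is empty); this is
NOT progress on the crux. [folklore] -/
theorem fastFloorUpgrade_vacuous : FastRelaxingFamily → UniformRelaxationWitness :=
  fun hf => (fastRelaxingFamily_false hf).elim

/-! ## 8. Toy of §3: the swept single mode (2×2 rotation–damping) — sweeping cancels the absorbed
power, uniformly-in-`U` enveloped relaxation notwithstanding; the energy caps the cancellation -/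

section Toy

/-- **Swept-mode lag kernel.** In the frame of a uniform sweep at angular rate `U` a single Fourier mode
relaxing at rate `γ` has lag kernel `K_U(τ) = L e^{-γτ} cos(Uτ)`: envelope `|K_U| ≤ L e^{-γτ}` uniform
in `U`, `K_U(0) = L`, yet its zero-frequency mass (the absorbed power) is `P(U) = γL/(γ² + U²)`
(tree: `Literature.Analysis.SpecialFunctions.integral_exp_neg_mul_cos`). [folklore] -/
theorem toy_sweptMode_power {γ : ℝ} (hγ : 0 < γ) (U L : ℝ) :
    ∫ τ in Ioi (0 : ℝ), L * (Real.exp (-(γ * τ)) * Real.cos (U * τ)) = L * (γ / (γ ^ 2 + U ^ 2)) := by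
  rw [integral_const_mul, Literature.Analysis.SpecialFunctions.integral_exp_neg_mul_cos hγ U]

/-- The envelope of the swept-mode kernel does not see the sweep. [folklore] -/
theorem toy_sweptMode_envelope (γ U L τ : ℝ) (hL : 0 ≤ L) :
    |L * (Real.exp (-(γ * τ)) * Real.cos (U * τ))| ≤ L * Real.exp (-(γ * τ)) := by
  rw [abs_mul, abs_of_nonneg hL, abs_mul, abs_of_pos (Real.exp_pos _), ← mul_assoc]
  exact mul_le_of_le_one_right (by positivity) (Real.abs_cos_le_one _)

/-- **Fast sweeping kills the absorbed power**: `P(U) → 0` as `U → ∞` (Green–Kubo cancellation, the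
only mechanism found against the floor). [folklore] -/
theorem toy_sweptMode_power_tendsto_zero (γ L : ℝ) :
    Tendsto (fun U : ℝ => L * (γ / (γ ^ 2 + U ^ 2))) atTop (𝓝 0) := by
  have h1 : Tendsto (fun U : ℝ => γ ^ 2 + U ^ 2) atTop atTop :=
    tendsto_atTop_add_const_left _ _ (tendsto_pow_atTop two_ne_zero)
  have h2 : Tendsto (fun U : ℝ => γ / (γ ^ 2 + U ^ 2)) atTop (𝓝 0) := tendsto_const_nhds.div_atTop h1
  simpa using h2.const_mul L

/-- **The energy caps the cancellation**: a sweep of bounded rate `U² ≤ U₀²` leaves the floor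
`γL/(γ² + U₀²)`; in the crux `U ∼ 2πk × (sweeping speed)` and the speed is capped by the energy — the
reason no bounded-energy toy kills the floor (§3). [folklore] -/
theorem toy_sweptMode_power_floor {γ U U₀ L : ℝ} (hγ : 0 < γ) (hL : 0 ≤ L) (hU : U ^ 2 ≤ U₀ ^ 2) :
    L * (γ / (γ ^ 2 + U₀ ^ 2)) ≤ L * (γ / (γ ^ 2 + U ^ 2)) := by
  have h1 : 0 < γ ^ 2 + U ^ 2 := by positivity
  gcongr

end Toy

end Summit.AnomalousDissipation.AnomalousDissipation.Cruxes.FloorUpgrade.Disproof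

end
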